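import Literature.NumberTheory.LFunctions.KeiperLiAsymptoticCriteria
import Literature.NumberTheory.ConnesConsani2021.SineIntegralAsymptotics
import Literature.Analysis.Fourier.DirichletIntegral
import Literature.NumberTheory.LFunctions.ZetaOrdinateDictionary
import Literature.NumberTheory.LFunctions.RudnickSarnakZeros
import Literature.NumberTheory.LFunctions.KeiperLiAsymptoticCriteriaProofs
import Literature.NumberTheory.ConnesConsani2021.SineIntegralLogAsymptotics
import Mathlib.Analysis.SpecialFunctions.Trigonometric.Arctan
import Mathlib.Analysis.PSeries
import HarnessLib

/-!
# Oesterlé's argument: `(NT) ⇒ (REs)` for zeros on the critical line ([Voros2006] §3) — proofs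

LINE 1 — FRAMING: RH-FREE literature.  A theorem of REAL ANALYSIS about point configurations
`½ ± iτ_k` on the line `Re s = ½` (no zeta function involved): if the counting function obeys
`N(T) = 2T[2R₋₂(log T − 1) + R₋₁] + O(T^α)`, `α < 1`, then the Li-type sums
`λ_n = Σ_k 2(1 − Re(1 − 1/ρ_k)ⁿ)` satisfy `λ_n = 2πn[2R₋₂(log n − 1 + γ) + R₋₁] + o(n)`.  Its instance for `ζ`
under RH is an RH-CONSEQUENCE (`Voros2006_thm_onlyif`), never progress toward RH.  Cell rh-crit, corpus C2/dbl
row «R4-VorosL+»; bears_on: L-C/L-P (COLUMN 4, Li).  WHAT THIS IS NOT: any claim about RH — nothing here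
bears on the truth of the Riemann Hypothesis.

This file discharges (modulo one classical constant, see below) the named fact
`Literature.NumberTheory.LFunctions.Voros2006_NT_REs` of `KeiperLiAsymptoticCriteria.lean`, following the
printed proof — J. Oesterlé's argument as worded by A. Voros, *Sharpenings of Li's criterion for the
Riemann Hypothesis*, Math. Phys. Anal. Geom. 9 (2006) 53–63 = arXiv:math/0506326, §3 p.5–6 (held text
`paper:arxiv-math_0506326`, chunk p0005:L60–L80):

> «When all the zeros lie on the critical line, first transform the summation (LDef) into a Stieltjes
> integral (where `θ(T) = 2 arctan(1/2T)`): `λ_n = 2∫₀^∞ [1 − cos nθ(T)] dN(T)`, then integrate by parts: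
> `n⁻¹λ_n = 2∫₀^π sin nθ N(½cot(θ/2)) dθ`.  Now replace `N(T)` by its large-`T` form (NT) neglecting `δN(T)`
> and other `O(θ^{−α})` terms: the error is `o(1)` by the Riemann–Lebesgue lemma, mainly because (NT) makes
> `δN(½cot(θ/2))` integrable over the closed interval `[0, π]`; hence
> `n⁻¹λ_n = ∫₀^π sin nθ (1/θ)[8R₋₂(log(1/θ) − 1) + 4R₋₁] dθ + o(1)`.  Next, change variable: `nθ = t`, then
> replace upper `t`-bound `nπ` by `+∞` again with an `o(1)` error; thus
> `λ_n = n∫₀^∞ (sin t/t)[8R₋₂(log(n/t) − 1) + 4R₋₁] dt (mod o(n))`, and the last integral evaluates in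
> closed form [GR] to yield (REs).»

## Architecture (the printed steps, in the angle variable `t = θ`, all integrals absolutely convergent)

* §S1 `one_sub_inv_eq_exp`, `summand_eq`: `1 − 1/(½ + iτ) = e^{iθ(τ)}`, `θ(τ) = 2 arctan(1/(2τ)) ∈ (0, π)`,
  so the summand is `2(1 − cos nθ(τ_k))` (the printed `[1 − cos nθ(T)]`).
* §S2 `le_theta_iff`, `Tinv_le`, `Tinv_ge`: the inverse map `T = ½cot(θ/2) = 1/(2 tan(θ/2))`, with
  `1/θ − θ/8 ≤ ½cot(θ/2) ≤ 1/θ`.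
* §S3 `summable_inv_sq`: `(NT)` ⇒ `N(T) ≤ A T^{3/2}` ⇒ `Σ 1/τ_k² < ∞` (convergence of `λ_n`; Fubini majorant).
* §S4 `tsum_eq_integral`: the Stieltjes integration by parts, done as a layer-cake/Fubini identity
  `Σ_k 2(1 − cos nϑ_k) = ∫₀^∞ Ñ(t)·2n sin(nt) dt`, `Ñ(t) = #{k : t ≤ ϑ_k} = N(½cot(t/2))`.
* §S5 `exists_error_bound`, `integrableOn_error`: `E := Ñ − 𝟙_{(0,π)}·M`, `M(t) = (1/t)[4R₋₂(log(1/t) − 1) + 2R₋₁]`,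
  satisfies `|E(t)| ≤ K + C t^{−α⁺}` on `(0, π)` (`α⁺ = max α 0 < 1`), hence `E ∈ L¹(0, ∞)`.
* §S6 `tendsto_error_integral`: Riemann–Lebesgue (`Literature.Analysis.Fourier.tendsto_integral_Ioi_mul_sin_atTop`).
* §S7 `integral_M_mul_sin`: the substitution `nθ = t`: `∫₀^π M(t) sin(nt) dt = a(log n·Si(nπ) − L(nπ)) + b·Si(nπ)`,
  `a = 4R₋₂`, `b = 2R₋₁ − 4R₋₂`, `Si(x) = ∫₀ˣ sin s/s` (the tree's `sinIntegral`), `L(A) = ∫₀^A log s·sin s/s ds`.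
* §S8 `NT_REs_of_logSineIntegral`: assembly — `λ_n − 2πn[2R₋₂(log n − 1 + γ) + R₋₁]
  = 2n·[a log n(Si(nπ) − π/2) − a(L(nπ) + πγ/2) + b(Si(nπ) − π/2) + ∫E sin(n·)] = o(n)`, using the tree's
  `∫₀^∞ sin t/t = π/2` with rate (`tendsto_sinIntegral_atTop`, `tendsto_log_mul_sinIntegral_sub`,
  `SineIntegralAsymptotics.lean`) and, as the single hypothesis `hJ`, the classical constant «[GR]»
  `∫₀^∞ log s·sin s/s ds = −πγ/2` (Gradshteyn–Ryzhik 4.421 1).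

Deviation from print (said so): instead of «replace upper `t`-bound `nπ` by `+∞` with an `o(1)` error» we keep the
finite upper limit `nπ` and use the RATE `log x·(Si(x) − π/2) → 0` of the tree — the same estimate in a different
order.  The theorems are stated for the hypothesis `(NT)` exactly as typed in `Voros2006_NT_REs` (`=O[atTop]` with
real exponent `α < 1`; `R₋₂`, `R₋₁` arbitrary reals).

* §S9 `thm_onlyif_of_logSineIntegral`: the `ζ` instance — under RH every non-trivial zero is `½ + i Im ρ`,
  `λ_n = Σ_ρ m(ρ) Re[1 − (1 − 1/ρ)ⁿ]` (`keiperLiCoeff_eq_tsum_zeros`) is re-indexed by the ordinates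
  `γ_k = zetaOrdinate k` (`tsum_nontrivialZeros_eq_tsum_zetaOrdinate`, conjugate symmetry), and `(NT)` for
  `#{k : γ_k ≤ T} = N(T)` with `R₋₂ = 1/(8π)`, `R₋₁ = −log(2π)/(4π)` (eq. (EX)) is the Riemann–von Mangoldt
  formula (`riemann_von_mangoldt_holds`, `zetaZeroCount_eq_ncard_holds`); so §S8 gives
  `RH ⇒ λ_n = ½n(log n − 1 + γ − log 2π) + o(n)` = `Voros2006_thm_onlyif`, again modulo `hJ`.

* §S10 the discharges: the constant «[GR]» `∫₀^∞ log s·sin s/s ds = −πγ/2` (Gradshteyn–Ryzhik 4.421 1) is the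
  tree's `Literature.NumberTheory.ConnesConsani2021.tendsto_intervalIntegral_sin_mul_log_div`
  (`SineIntegralLogAsymptotics.lean`, cell rh-crit W2), whence **`Voros2006_NT_REs_holds`**,
  **`Voros2006_thm_onlyif_holds`**, and the unconditional form `Voros2006_thm_iff_holds` of [Voros2006]'s
  asymptotic criterion `RH ⇔ λ_n = ½n(log n − 1 + γ − log 2π) + o(n)` (RH-EQUIVALENT, l.1: an equivalence
  is not a proof of either side) from the tree's `Voros2006_thm_iff` / `Voros2006_thm_if_holds`.

NOT here: the evaluation of the log-sine integral itself (imported).  No definitions, no named facts.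

## References

* A. Voros, *Sharpenings of Li's criterion for the Riemann Hypothesis*, Math. Phys. Anal. Geom. 9 (2006) 53–63,
  doi:10.1007/s11040-005-9002-8, arXiv:math/0506326 — §3, p.5–6 (Oesterlé's argument). [Voros2006]
* E. C. Titchmarsh, *Introduction to the Theory of Fourier Integrals*, 2nd ed. (1948), §1.9 (Dirichlet's integral,
  Riemann–Lebesgue). [Titchmarsh1948]
-/

noncomputable section

open Filter Topology Asymptotics Set MeasureTheory Real

namespace Literature.NumberTheory.LFunctions

namespace Voros2006Oesterle

/-! ## S1. The per-term identity `1 − 1/ρ = e^{iϑ}`, `ϑ = 2 arctan(1/(2τ))` -/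

/-- For `τ > 0` and `ρ = ½ + iτ`: `1 − 1/ρ = exp(iϑ)` with `ϑ = θ(τ) = 2 arctan(1/(2τ))` — the zeros on the critical line give unimodular `1 − 1/ρ` («`λ_n = 2∫₀^∞[1 − cos nθ(T)] dN(T)`, where `θ(T) = 2 arctan(1/2T)`»).
[cite: Voros2006, §3 p.5–6 (Oesterlé's argument; arXiv:math/0506326 chunk p0005:L60–L80)] -/
theorem one_sub_inv_eq_exp {τ : ℝ} (hτ : 0 < τ) :
    (1 : ℂ) - 1 / ((1 / 2 : ℂ) + τ * Complex.I) =
      Complex.exp ((2 * Real.arctan (1 / (2 * τ)) : ℝ) * Complex.I) := by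
  set ϑ : ℝ := 2 * Real.arctan (1 / (2 * τ)) with hϑ
  have hD : τ ^ 2 + 1 / 4 ≠ 0 := by positivity
  -- half-angle substitutions `cos(2 arctan u) = (1 − u²)/(1 + u²)`, `sin(2 arctan u) = 2u/(1 + u²)`
  have hcos2 : ∀ u : ℝ, Real.cos (2 * Real.arctan u) = (1 - u ^ 2) / (1 + u ^ 2) := by
    intro u
    rw [Real.cos_two_mul, Real.cos_sq_arctan]
    have h : 0 < 1 + u ^ 2 := by positivity
    field_simp
    ring
  have hsin2 : ∀ u : ℝ, Real.sin (2 * Real.arctan u) = 2 * u / (1 + u ^ 2) := by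
    intro u
    rw [Real.sin_two_mul, Real.sin_arctan, Real.cos_arctan]
    have h : 0 < 1 + u ^ 2 := by positivity
    have hs : Real.sqrt (1 + u ^ 2) * Real.sqrt (1 + u ^ 2) = 1 + u ^ 2 := Real.mul_self_sqrt h.le
    have hs0 : Real.sqrt (1 + u ^ 2) ≠ 0 := (Real.sqrt_pos.2 h).ne'
    calc 2 * (u / Real.sqrt (1 + u ^ 2)) * (1 / Real.sqrt (1 + u ^ 2))
        = 2 * u / (Real.sqrt (1 + u ^ 2) * Real.sqrt (1 + u ^ 2)) := by field_simp
      _ = 2 * u / (1 + u ^ 2) := by rw [hs]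
  have hc : Real.cos ϑ = (τ ^ 2 - 1 / 4) / (τ ^ 2 + 1 / 4) := by
    rw [hϑ, hcos2]
    have : τ ≠ 0 := hτ.ne'
    field_simp
    ring
  have hs : Real.sin ϑ = τ / (τ ^ 2 + 1 / 4) := by
    rw [hϑ, hsin2]
    have : τ ≠ 0 := hτ.ne'
    field_simp
    ring
  set ρ : ℂ := (1 / 2 : ℂ) + τ * Complex.I with hρdef
  have hρ : ρ ≠ 0 := by
    intro h
    have := congrArg Complex.re h
    simp [hρdef] at this
  have hre : (τ ^ 2 - 1 / 4) / (τ ^ 2 + 1 / 4) * (1 / 2) - τ / (τ ^ 2 + 1 / 4) * τ = -(1 / 2) := by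
    field_simp
    ring
  have him : (τ ^ 2 - 1 / 4) / (τ ^ 2 + 1 / 4) * τ + τ / (τ ^ 2 + 1 / 4) * (1 / 2) = τ := by
    field_simp
    ring
  have h1 : (1 : ℂ) - 1 / ρ = (ρ - 1) / ρ := by field_simp
  rw [h1, div_eq_iff hρ, Complex.exp_mul_I, ← Complex.ofReal_cos, ← Complex.ofReal_sin, hc, hs]
  apply Complex.ext
  · simp only [hρdef, Complex.sub_re, Complex.add_re, Complex.mul_re, Complex.one_re,
      Complex.ofReal_re, Complex.ofReal_im, Complex.I_re, Complex.I_im, Complex.mul_im,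
      Complex.add_im]
    norm_num
    linarith [hre]
  · simp only [hρdef, Complex.sub_im, Complex.add_im, Complex.mul_im, Complex.one_im,
      Complex.ofReal_re, Complex.ofReal_im, Complex.I_re, Complex.I_im, Complex.mul_re,
      Complex.add_re]
    norm_num
    linarith [him]

/-- The summand of `λ_n`: `2(1 − Re (1 − 1/ρ_k)ⁿ) = 2(1 − cos(n θ(τ_k)))`.
[cite: Voros2006, §3 p.5–6 (Oesterlé's argument; arXiv:math/0506326 chunk p0005:L60–L80)] -/
theorem summand_eq {τ : ℝ} (hτ : 0 < τ) (n : ℕ) :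
    2 * (1 - ((1 - 1 / ((1 / 2 : ℂ) + τ * Complex.I)) ^ n).re) =
      2 * (1 - Real.cos (n * (2 * Real.arctan (1 / (2 * τ))))) := by
  rw [one_sub_inv_eq_exp hτ, ← Complex.exp_nat_mul, ← mul_assoc]
  have : ((n : ℂ) * ((2 * Real.arctan (1 / (2 * τ)) : ℝ) : ℂ)) =
      (((n : ℝ) * (2 * Real.arctan (1 / (2 * τ))) : ℝ) : ℂ) := by push_cast; ring
  rw [this, Complex.exp_ofReal_mul_I_re]

/-! ## S2. The angle `ϑ(τ)` and its inverse `T(t) = 1/(2 tan(t/2))` -/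

/-- `0 < θ(τ)` for `τ > 0`.
[cite: Voros2006, §3 p.5–6 (Oesterlé's argument; arXiv:math/0506326 chunk p0005:L60–L80)] -/
theorem theta_pos {τ : ℝ} (hτ : 0 < τ) : 0 < 2 * Real.arctan (1 / (2 * τ)) := by
  have : 0 < Real.arctan (1 / (2 * τ)) := Real.arctan_pos.2 (by positivity)
  linarith

/-- `θ(τ) < π`.
[cite: Voros2006, §3 p.5–6 (Oesterlé's argument; arXiv:math/0506326 chunk p0005:L60–L80)] -/
theorem theta_lt_pi (τ : ℝ) : 2 * Real.arctan (1 / (2 * τ)) < π := by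
  have := Real.arctan_lt_pi_div_two (1 / (2 * τ))
  linarith

/-- `θ(τ) ≤ 1/τ` for `τ > 0`.
[cite: Voros2006, §3 p.5–6 (Oesterlé's argument; arXiv:math/0506326 chunk p0005:L60–L80)] -/
theorem theta_le_inv {τ : ℝ} (hτ : 0 < τ) : 2 * Real.arctan (1 / (2 * τ)) ≤ 1 / τ := by
  -- `arctan u ≤ u` for `u ≥ 0` (from `x ≤ tan x` on `[0, π/2)`)
  have : Real.arctan (1 / (2 * τ)) ≤ 1 / (2 * τ) := by
    have h := Real.le_tan (Real.arctan_nonneg.2 (by positivity : (0:ℝ) ≤ 1 / (2 * τ)))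
      (Real.arctan_lt_pi_div_two _)
    rwa [Real.tan_arctan] at h
  calc 2 * Real.arctan (1 / (2 * τ)) ≤ 2 * (1 / (2 * τ)) := by linarith
    _ = 1 / τ := by field_simp

/-- The inverse map `T = ½cot(θ/2)`: for `τ > 0` and `t ∈ (0, π)`, `t ≤ θ(τ) ↔ τ ≤ 1/(2 tan(t/2))` («`N(½ cot(θ/2))`»).
[cite: Voros2006, §3 p.5–6 (Oesterlé's argument; arXiv:math/0506326 chunk p0005:L60–L80)] -/
theorem le_theta_iff {τ t : ℝ} (hτ : 0 < τ) (ht : 0 < t) (htπ : t < π) :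
    t ≤ 2 * Real.arctan (1 / (2 * τ)) ↔ τ ≤ 1 / (2 * Real.tan (t / 2)) := by
  have ht2 : 0 < t / 2 := by linarith
  have ht2' : t / 2 < π / 2 := by linarith
  have htan : 0 < Real.tan (t / 2) := Real.tan_pos_of_pos_of_lt_pi_div_two ht2 ht2'
  have ha1 : -(π / 2) < Real.arctan (1 / (2 * τ)) := Real.neg_pi_div_two_lt_arctan _
  have ha2 : Real.arctan (1 / (2 * τ)) < π / 2 := Real.arctan_lt_pi_div_two _
  constructor
  · intro h
    have h' : t / 2 ≤ Real.arctan (1 / (2 * τ)) := by linarith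
    -- tan monotone on (-π/2, π/2)
    have : Real.tan (t / 2) ≤ Real.tan (Real.arctan (1 / (2 * τ))) := by
      rcases h'.eq_or_lt with h'' | h''
      · rw [h'']
      · exact (Real.tan_lt_tan_of_lt_of_lt_pi_div_two (by linarith) ha2 h'').le
    rw [Real.tan_arctan] at this
    rw [le_div_iff₀ (by positivity)]
    calc τ * (2 * Real.tan (t / 2)) = 2 * τ * Real.tan (t / 2) := by ring
      _ ≤ 2 * τ * (1 / (2 * τ)) := by gcongr
      _ = 1 := by field_simp
  · intro h
    have h1 : Real.tan (t / 2) ≤ 1 / (2 * τ) := by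
      rw [le_div_iff₀ (by positivity)] at h ⊢
      linarith
    -- arctan monotone
    have h2 : Real.arctan (Real.tan (t / 2)) ≤ Real.arctan (1 / (2 * τ)) :=
      Real.arctan_strictMono.monotone h1
    rw [Real.arctan_tan (by linarith) ht2'] at h2
    linarith

/-- `½cot(t/2) = 1/(2 tan(t/2)) ≤ 1/t` on `(0, π)` (from `x < tan x`).
[cite: Voros2006, §3 p.5–6 (Oesterlé's argument; arXiv:math/0506326 chunk p0005:L60–L80)] -/
theorem Tinv_le {t : ℝ} (ht : 0 < t) (htπ : t < π) : 1 / (2 * Real.tan (t / 2)) ≤ 1 / t := by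
  have ht2 : 0 < t / 2 := by linarith
  have ht2' : t / 2 < π / 2 := by linarith
  have htan : t / 2 < Real.tan (t / 2) := Real.lt_tan ht2 ht2'
  have htan0 : 0 < Real.tan (t / 2) := Real.tan_pos_of_pos_of_lt_pi_div_two ht2 ht2'
  rw [div_le_div_iff₀ (mul_pos two_pos htan0) ht]
  linarith

/-- `1/t − t/8 ≤ 1/(2 tan(t/2))` on `(0, π)` (from `cos x ≥ 1 − x²/2` and `sin x ≤ x`): `½cot(θ/2) = 1/θ + O(θ)`, the «other `O(θ^{−α})` terms».
[cite: Voros2006, §3 p.5–6 (Oesterlé's argument; arXiv:math/0506326 chunk p0005:L60–L80)] -/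
theorem Tinv_ge {t : ℝ} (ht : 0 < t) (htπ : t < π) : 1 / t - t / 8 ≤ 1 / (2 * Real.tan (t / 2)) := by
  have ht2 : 0 < t / 2 := by linarith
  have ht2' : t / 2 < π / 2 := by linarith
  have hsin : 0 < Real.sin (t / 2) := Real.sin_pos_of_pos_of_lt_pi ht2 (by linarith)
  have hsinle : Real.sin (t / 2) ≤ t / 2 := Real.sin_le ht2.le
  have hcos : 1 - (t / 2) ^ 2 / 2 ≤ Real.cos (t / 2) := Real.one_sub_sq_div_two_le_cos
  have htan : 0 < Real.tan (t / 2) := Real.tan_pos_of_pos_of_lt_pi_div_two ht2 ht2'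
  rw [Real.tan_eq_sin_div_cos] at htan ⊢
  have hcpos : 0 < Real.cos (t / 2) := Real.cos_pos_of_mem_Ioo ⟨by linarith, ht2'⟩
  -- 1/t - t/8 = (1 - t²/8)/t ≤ cos/(2 sin)
  rw [show 1 / (2 * (Real.sin (t / 2) / Real.cos (t / 2))) = Real.cos (t / 2) / (2 * Real.sin (t / 2)) by
    field_simp]
  rw [show 1 / t - t / 8 = (1 - (t / 2) ^ 2 / 2) / t by field_simp; ring]
  rw [div_le_div_iff₀ ht (by positivity)]
  calc (1 - (t / 2) ^ 2 / 2) * (2 * Real.sin (t / 2)) ≤ Real.cos (t / 2) * (2 * Real.sin (t / 2)) := by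
        gcongr
    _ ≤ Real.cos (t / 2) * (2 * (t / 2)) := by gcongr
    _ = Real.cos (t / 2) * t := by ring


/-! ## S3. Growth consequences of `(NT)` -/

/-- The counting sets `{k | τ_k ≤ T}` are finite (`τ_k → ∞`), so `N(T)` is an honest count.
[cite: Voros2006, §3 p.5–6 (Oesterlé's argument; arXiv:math/0506326 chunk p0005:L60–L80)] -/
theorem finite_le {τ : ℕ → ℝ} (hlim : Tendsto τ atTop atTop) (T : ℝ) :
    ({k : ℕ | τ k ≤ T} : Set ℕ).Finite := by
  obtain ⟨k₀, hk₀⟩ := (hlim.eventually_gt_atTop T).exists_forall_of_atTop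
  refine (Set.finite_lt_nat k₀).subset fun k hk => ?_
  simp only [Set.mem_setOf_eq] at hk ⊢
  by_contra h
  exact absurd (hk₀ k (not_lt.1 h)) (not_lt.2 hk)

/-- `k + 1 ≤ N(τ_k)` (the ordinates `τ_0 ≤ … ≤ τ_k`, listed with multiplicity, are all `≤ τ_k`).
[cite: Voros2006, §3 p.5–6 (Oesterlé's argument; arXiv:math/0506326 chunk p0005:L60–L80)] -/
theorem succ_le_ncard {τ : ℕ → ℝ} (hmono : Monotone τ) (hlim : Tendsto τ atTop atTop) (k : ℕ) :
    (k : ℝ) + 1 ≤ (({j : ℕ | τ j ≤ τ k} : Set ℕ).ncard : ℝ) := by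
  have hsub : (↑(Finset.range (k + 1)) : Set ℕ) ⊆ {j : ℕ | τ j ≤ τ k} := by
    intro j hj
    simp only [Finset.coe_range, Set.mem_Iio] at hj
    exact hmono (Nat.lt_succ_iff.1 hj)
  have := Set.ncard_le_ncard hsub (finite_le hlim (τ k))
  rw [Set.ncard_coe_finset, Finset.card_range] at this
  exact_mod_cast this

/-- Unpacking `(NT)`: an explicit bound `|N(T) − 2T[2R₋₂(log T − 1) + R₋₁]| ≤ C·T^{α⁺}` for `T ≥ T₀ ≥ 1`, `α⁺ = max α 0`.
[cite: Voros2006, §3 p.5–6 (Oesterlé's argument; arXiv:math/0506326 chunk p0005:L60–L80)] -/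
theorem exists_NT_bound {τ : ℕ → ℝ} {R₂ R₁ α : ℝ}
    (hNT : (fun T : ℝ ↦ (Nat.card {k : ℕ | τ k ≤ T} : ℝ) - 2 * T * (2 * R₂ * (Real.log T - 1) + R₁))
      =O[atTop] (fun T : ℝ ↦ T ^ α)) :
    ∃ C T₀ : ℝ, 0 ≤ C ∧ 1 ≤ T₀ ∧ ∀ T, T₀ ≤ T →
      |(({k : ℕ | τ k ≤ T} : Set ℕ).ncard : ℝ) - 2 * T * (2 * R₂ * (Real.log T - 1) + R₁)| ≤
        C * T ^ (max α 0) := by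
  obtain ⟨C, hC, h⟩ := hNT.exists_pos
  obtain ⟨a, ha⟩ := eventually_atTop.1 h.bound
  refine ⟨C, max a 1, hC.le, le_max_right _ _, fun T hT => ?_⟩
  have hT1 : 1 ≤ T := le_trans (le_max_right _ _) hT
  have hT0 : 0 < T := by linarith
  have h1 := ha T (le_trans (le_max_left _ _) hT)
  simp only [Nat.card_coe_set_eq, Real.norm_eq_abs] at h1
  calc _ ≤ C * |T ^ α| := h1
    _ = C * T ^ α := by rw [abs_of_nonneg (Real.rpow_nonneg hT0.le _)]
    _ ≤ C * T ^ (max α 0) :=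
        mul_le_mul_of_nonneg_left (Real.rpow_le_rpow_of_exponent_le hT1 (le_max_left _ _)) hC.le

/-- The smooth main part `2T[2R₋₂(log T − 1) + R₋₁]` is `≤ (12|R₋₂| + 2|R₋₁|)·T^{3/2}` for `T ≥ 1` (crude: `log T ≤ 2√T`).
[cite: Voros2006, §3 p.5–6 (Oesterlé's argument; arXiv:math/0506326 chunk p0005:L60–L80)] -/
theorem smooth_le_pow {R₂ R₁ T : ℝ} (hT : 1 ≤ T) :
    2 * T * (2 * R₂ * (Real.log T - 1) + R₁) ≤ (12 * |R₂| + 2 * |R₁|) * T ^ (3 / 2 : ℝ) := by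
  have hT0 : 0 < T := by linarith
  have hlog0 : 0 ≤ Real.log T := Real.log_nonneg hT
  have hlog : Real.log T ≤ 2 * T ^ (1 / 2 : ℝ) := by
    have := Real.log_le_rpow_div hT0.le (by norm_num : (0:ℝ) < 1 / 2)
    linarith
  have h1 : 1 ≤ T ^ (1 / 2 : ℝ) := Real.one_le_rpow hT (by norm_num)
  have h32 : T ^ (3 / 2 : ℝ) = T * T ^ (1 / 2 : ℝ) := by
    rw [show (3 / 2 : ℝ) = 1 + 1 / 2 by norm_num, Real.rpow_add hT0, Real.rpow_one]
  have hA : 2 * R₂ * (Real.log T - 1) + R₁ ≤ (6 * |R₂| + |R₁|) * T ^ (1 / 2 : ℝ) := by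
    have e1 : 2 * R₂ * (Real.log T - 1) ≤ 2 * |R₂| * (Real.log T + 1) := by
      have : |2 * R₂ * (Real.log T - 1)| ≤ 2 * |R₂| * (Real.log T + 1) := by
        rw [abs_mul, abs_mul, abs_two]
        gcongr
        rw [abs_le]; constructor <;> linarith
      exact le_trans (le_abs_self _) this
    have e2 : R₁ ≤ |R₁| * T ^ (1 / 2 : ℝ) := le_trans (le_abs_self _) (le_mul_of_one_le_right (abs_nonneg _) h1)
    have e3 : Real.log T + 1 ≤ 3 * T ^ (1 / 2 : ℝ) := by linarith
    calc 2 * R₂ * (Real.log T - 1) + R₁ ≤ 2 * |R₂| * (Real.log T + 1) + |R₁| * T ^ (1 / 2 : ℝ) := by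
          linarith
      _ ≤ 2 * |R₂| * (3 * T ^ (1 / 2 : ℝ)) + |R₁| * T ^ (1 / 2 : ℝ) := by gcongr
      _ = (6 * |R₂| + |R₁|) * T ^ (1 / 2 : ℝ) := by ring
  rw [h32]
  calc 2 * T * (2 * R₂ * (Real.log T - 1) + R₁) ≤ 2 * T * ((6 * |R₂| + |R₁|) * T ^ (1 / 2 : ℝ)) := by
        gcongr
    _ = (12 * |R₂| + 2 * |R₁|) * (T * T ^ (1 / 2 : ℝ)) := by ring

/-- `N(T) ≤ A·T^{3/2}` for `T ≥ T₁` (a crude consequence of `(NT)`, enough for `Σ 1/τ_k² < ∞`).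
[cite: Voros2006, §3 p.5–6 (Oesterlé's argument; arXiv:math/0506326 chunk p0005:L60–L80)] -/
theorem exists_ncard_le_pow {τ : ℕ → ℝ} {R₂ R₁ α : ℝ} (hα : α < 1)
    (hNT : (fun T : ℝ ↦ (Nat.card {k : ℕ | τ k ≤ T} : ℝ) - 2 * T * (2 * R₂ * (Real.log T - 1) + R₁))
      =O[atTop] (fun T : ℝ ↦ T ^ α)) :
    ∃ A T₁ : ℝ, 0 < A ∧ 1 ≤ T₁ ∧ ∀ T, T₁ ≤ T →
      (({k : ℕ | τ k ≤ T} : Set ℕ).ncard : ℝ) ≤ A * T ^ (3 / 2 : ℝ) := by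
  obtain ⟨C, T₀, hC, hT₀, h⟩ := exists_NT_bound hNT
  refine ⟨12 * |R₂| + 2 * |R₁| + C + 1, T₀, by positivity, hT₀, fun T hT => ?_⟩
  have hT1 : 1 ≤ T := le_trans hT₀ hT
  have hT0 : 0 < T := by linarith
  have h1 := h T hT
  rw [abs_le] at h1
  have h2 := smooth_le_pow (R₂ := R₂) (R₁ := R₁) hT1
  have h3 : C * T ^ (max α 0) ≤ C * T ^ (3 / 2 : ℝ) :=
    mul_le_mul_of_nonneg_left
      (Real.rpow_le_rpow_of_exponent_le hT1 (max_le (by linarith) (by norm_num))) hC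
  have h4 : 0 ≤ T ^ (3 / 2 : ℝ) := Real.rpow_nonneg hT0.le _
  nlinarith

/-- **`Σ_k 1/τ_k² < ∞`** under `(NT)`: `k + 1 ≤ N(τ_k) ≤ A τ_k^{3/2}` gives `1/τ_k² ≤ A^{4/3} k^{−4/3}` (this is what makes `λ_n = Σ_k 2(1 − cos nθ(τ_k))` converge).
[cite: Voros2006, §3 p.5–6 (Oesterlé's argument; arXiv:math/0506326 chunk p0005:L60–L80)] -/
theorem summable_inv_sq {τ : ℕ → ℝ} {R₂ R₁ α : ℝ} (hτ : ∀ k, 0 < τ k) (hmono : Monotone τ)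
    (hlim : Tendsto τ atTop atTop) (hα : α < 1)
    (hNT : (fun T : ℝ ↦ (Nat.card {k : ℕ | τ k ≤ T} : ℝ) - 2 * T * (2 * R₂ * (Real.log T - 1) + R₁))
      =O[atTop] (fun T : ℝ ↦ T ^ α)) :
    Summable (fun k : ℕ => 1 / τ k ^ 2) := by
  obtain ⟨A, T₁, hA, -, h⟩ := exists_ncard_le_pow hα hNT
  have hev : ∀ᶠ k : ℕ in atTop, (k : ℝ) + 1 ≤ A * τ k ^ (3 / 2 : ℝ) := by
    filter_upwards [hlim.eventually_ge_atTop T₁] with k hk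
    exact le_trans (succ_le_ncard hmono hlim k) (h _ hk)
  have hO : (fun k : ℕ => 1 / τ k ^ 2) =O[atTop] (fun k : ℕ => ((k : ℝ) ^ (4 / 3 : ℝ))⁻¹) := by
    refine IsBigO.of_bound (A ^ (4 / 3 : ℝ)) ?_
    filter_upwards [hev, eventually_ge_atTop 1] with k hk hk1
    have hk0 : (0 : ℝ) < k := by exact_mod_cast hk1
    have hτ0 := hτ k
    have e1 : (k : ℝ) / A ≤ τ k ^ (3 / 2 : ℝ) := by
      rw [div_le_iff₀ hA]; linarith
    have e2 : ((k : ℝ) / A) ^ (4 / 3 : ℝ) ≤ (τ k ^ (3 / 2 : ℝ)) ^ (4 / 3 : ℝ) :=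
      Real.rpow_le_rpow (by positivity) e1 (by norm_num)
    rw [← Real.rpow_mul hτ0.le, show (3 / 2 : ℝ) * (4 / 3) = 2 by norm_num, Real.rpow_two,
      Real.div_rpow hk0.le hA.le] at e2
    have hkp : 0 < (k : ℝ) ^ (4 / 3 : ℝ) := Real.rpow_pos_of_pos hk0 _
    have hAp : 0 < A ^ (4 / 3 : ℝ) := Real.rpow_pos_of_pos hA _
    rw [Real.norm_eq_abs, Real.norm_eq_abs, abs_of_pos (by positivity), abs_of_pos (by positivity)]
    rw [div_le_iff₀ hAp] at e2
    rw [div_le_iff₀ (by positivity)]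
    calc (1 : ℝ) = (k : ℝ) ^ (4 / 3 : ℝ) * ((k : ℝ) ^ (4 / 3 : ℝ))⁻¹ := by field_simp
      _ ≤ τ k ^ 2 * A ^ (4 / 3 : ℝ) * ((k : ℝ) ^ (4 / 3 : ℝ))⁻¹ := by gcongr
      _ = A ^ (4 / 3 : ℝ) * ((k : ℝ) ^ (4 / 3 : ℝ))⁻¹ * τ k ^ 2 := by ring
  exact summable_of_isBigO_nat (Real.summable_nat_rpow_inv.2 (by norm_num)) hO

/-- `Σ_k θ(τ_k)² < ∞` (`θ(τ) ≤ 1/τ`).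
[cite: Voros2006, §3 p.5–6 (Oesterlé's argument; arXiv:math/0506326 chunk p0005:L60–L80)] -/
theorem summable_theta_sq {τ : ℕ → ℝ} {R₂ R₁ α : ℝ} (hτ : ∀ k, 0 < τ k) (hmono : Monotone τ)
    (hlim : Tendsto τ atTop atTop) (hα : α < 1)
    (hNT : (fun T : ℝ ↦ (Nat.card {k : ℕ | τ k ≤ T} : ℝ) - 2 * T * (2 * R₂ * (Real.log T - 1) + R₁))
      =O[atTop] (fun T : ℝ ↦ T ^ α)) :
    Summable (fun k : ℕ => (2 * Real.arctan (1 / (2 * τ k))) ^ 2) := by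
  refine Summable.of_nonneg_of_le (fun k => sq_nonneg _) (fun k => ?_) (summable_inv_sq hτ hmono hlim hα hNT)
  have h1 := theta_le_inv (hτ k)
  have h0 := (theta_pos (hτ k)).le
  calc (2 * Real.arctan (1 / (2 * τ k))) ^ 2 ≤ (1 / τ k) ^ 2 := pow_le_pow_left₀ h0 h1 2
    _ = 1 / τ k ^ 2 := by rw [one_div_pow]

/-- The series `λ_n = Σ_k 2(1 − cos(n θ(τ_k)))` converges (absolutely; terms `≤ n²θ_k²`).
[cite: Voros2006, §3 p.5–6 (Oesterlé's argument; arXiv:math/0506326 chunk p0005:L60–L80)] -/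
theorem summable_summand {τ : ℕ → ℝ} {R₂ R₁ α : ℝ} (hτ : ∀ k, 0 < τ k) (hmono : Monotone τ)
    (hlim : Tendsto τ atTop atTop) (hα : α < 1)
    (hNT : (fun T : ℝ ↦ (Nat.card {k : ℕ | τ k ≤ T} : ℝ) - 2 * T * (2 * R₂ * (Real.log T - 1) + R₁))
      =O[atTop] (fun T : ℝ ↦ T ^ α)) (n : ℕ) :
    Summable (fun k : ℕ => 2 * (1 - Real.cos (n * (2 * Real.arctan (1 / (2 * τ k)))))) := by
  refine Summable.of_nonneg_of_le (fun k => by linarith [Real.cos_le_one (n * (2 * Real.arctan (1 / (2 * τ k))))])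
    (fun k => ?_)
    ((summable_theta_sq hτ hmono hlim hα hNT).mul_left ((n : ℝ) ^ 2))
  calc _ ≤ (n * (2 * Real.arctan (1 / (2 * τ k)))) ^ 2 := by
        linarith [Real.one_sub_sq_div_two_le_cos (x := n * (2 * Real.arctan (1 / (2 * τ k))))]
    _ = (n : ℝ) ^ 2 * (2 * Real.arctan (1 / (2 * τ k))) ^ 2 := by ring


/-! ## S4. Layer-cake / Fubini: `λ_n = ∫₀^∞ Ñ(t)·2n sin(nt) dt`, `Ñ(t) = #{k : t ≤ ϑ_k}` -/

/-- For `t > 0` only finitely many `ϑ_k ≥ t` (since `Σ ϑ_k² < ∞` forces `ϑ_k → 0`): the counting function in the angle variable, `Ñ(t) = #{k : t ≤ ϑ_k}` (`= N(½cot(t/2))`), is finite.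
[cite: Voros2006, §3 p.5–6 (Oesterlé's argument; arXiv:math/0506326 chunk p0005:L60–L80)] -/
theorem finite_ge {ϑ : ℕ → ℝ} (hs : Summable (fun k => ϑ k ^ 2)) {t : ℝ}
    (ht : 0 < t) : ({k : ℕ | t ≤ ϑ k} : Set ℕ).Finite := by
  have hlim : Tendsto (fun k => ϑ k ^ 2) atTop (𝓝 0) := hs.tendsto_atTop_zero
  obtain ⟨k₀, hk₀⟩ := (hlim.eventually (gt_mem_nhds (show (0:ℝ) < t ^ 2 by positivity))).exists_forall_of_atTop
  refine (Set.finite_lt_nat k₀).subset fun k hk => ?_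
  simp only [Set.mem_setOf_eq] at hk ⊢
  by_contra h
  have h1 : ϑ k ^ 2 < t ^ 2 := hk₀ k (not_lt.1 h)
  have h2 : t ^ 2 ≤ ϑ k ^ 2 := pow_le_pow_left₀ ht.le hk 2
  linarith

/-- The layer representation replacing the Stieltjes integration by parts «`n⁻¹λ_n = 2∫₀^π sin nθ·N(½cot(θ/2)) dθ`»: `∫_{(0,∞)} 𝟙[t ≤ x]·2n sin(nt) dt = 2(1 − cos(nx))` for `x ≥ 0`.
[cite: Voros2006, §3 p.5–6 (Oesterlé's argument; arXiv:math/0506326 chunk p0005:L60–L80)] -/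
theorem integral_indicator_sin {x : ℝ} (hx : 0 ≤ x) (n : ℕ) :
    ∫ t in Ioi (0:ℝ), (Iic x).indicator (fun t => 2 * (n : ℝ) * Real.sin (n * t)) t =
      2 * (1 - Real.cos (n * x)) := by
  rw [setIntegral_indicator measurableSet_Iic, show Ioi (0:ℝ) ∩ Iic x = Ioc 0 x from rfl,
    ← intervalIntegral.integral_of_le hx]
  rcases Nat.eq_zero_or_pos n with rfl | hn
  · simp
  · have hn' : (n : ℝ) ≠ 0 := by exact_mod_cast hn.ne'
    have h1 : ∫ t in (0:ℝ)..x, Real.sin (n * t) = (1 - Real.cos (n * x)) / n := by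
      rw [intervalIntegral.integral_comp_mul_left (fun t => Real.sin t) hn', integral_sin]
      simp [smul_eq_mul]
      field_simp
    calc ∫ t in (0:ℝ)..x, 2 * (n : ℝ) * Real.sin (n * t)
        = 2 * (n : ℝ) * ∫ t in (0:ℝ)..x, Real.sin (n * t) := by
          rw [intervalIntegral.integral_const_mul]
      _ = 2 * (1 - Real.cos (n * x)) := by rw [h1]; field_simp

/-- Integrability of the layer functions `𝟙[t ≤ x]·2n sin(nt)` on `(0, ∞)`.
[cite: Voros2006, §3 p.5–6 (Oesterlé's argument; arXiv:math/0506326 chunk p0005:L60–L80)] -/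
theorem integrable_indicator_sin (x : ℝ) (n : ℕ) :
    Integrable (fun t => (Iic x).indicator (fun t => 2 * (n : ℝ) * Real.sin (n * t)) t)
      (volume.restrict (Ioi (0:ℝ))) := by
  rw [integrable_indicator_iff measurableSet_Iic]
  rw [IntegrableOn, Measure.restrict_restrict measurableSet_Iic,
    show Iic x ∩ Ioi (0:ℝ) = Ioc 0 x by ext; simp [and_comm]]
  have hc : Continuous (fun t : ℝ => 2 * (n : ℝ) * Real.sin (n * t)) := by fun_prop
  exact (hc.integrableOn_Icc (a := 0) (b := x)).mono_set Ioc_subset_Icc_self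

/-- `∫ ‖𝟙[t ≤ x]·2n sin(nt)‖ ≤ 2n²x²` (`|sin(nt)| ≤ nt ≤ nx` on `(0, x]`, a set of measure `x`) — the summable majorant for Fubini.
[cite: Voros2006, §3 p.5–6 (Oesterlé's argument; arXiv:math/0506326 chunk p0005:L60–L80)] -/
theorem integral_norm_indicator_sin_le {x : ℝ} (hx : 0 ≤ x) (n : ℕ) :
    ∫ t in Ioi (0:ℝ), ‖(Iic x).indicator (fun t => 2 * (n : ℝ) * Real.sin (n * t)) t‖ ≤
      2 * (n : ℝ) ^ 2 * x * x := by
  have h1 : ∀ t, ‖(Iic x).indicator (fun t => 2 * (n : ℝ) * Real.sin (n * t)) t‖ =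
      (Iic x).indicator (fun t => ‖2 * (n : ℝ) * Real.sin (n * t)‖) t := fun t => norm_indicator_eq_indicator_norm _ _
  simp_rw [h1]
  rw [setIntegral_indicator measurableSet_Iic, show Ioi (0:ℝ) ∩ Iic x = Ioc 0 x from rfl]
  have hμ : volume (Ioc (0:ℝ) x) < ⊤ := by simp
  have h2 := norm_setIntegral_le_of_norm_le_const hμ (f := fun t => ‖2 * (n : ℝ) * Real.sin (n * t)‖)
    (C := 2 * (n : ℝ) ^ 2 * x) (fun t ht => ?_)
  · rw [Real.volume_real_Ioc_of_le hx, sub_zero] at h2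
    refine le_trans (le_abs_self _) ?_
    rw [← Real.norm_eq_abs]
    exact h2
  · rw [norm_norm, norm_mul, norm_mul, Real.norm_eq_abs, Real.norm_eq_abs, Real.norm_eq_abs,
      abs_two, abs_of_nonneg (Nat.cast_nonneg n)]
    have hs : |Real.sin (n * t)| ≤ n * x := by
      calc |Real.sin (n * t)| ≤ |(n : ℝ) * t| := Real.abs_sin_le_abs
        _ = n * t := by rw [abs_of_nonneg (by have := ht.1.le; positivity)]
        _ ≤ n * x := by have := ht.2; gcongr
    calc 2 * (n : ℝ) * |Real.sin (n * t)| ≤ 2 * n * (n * x) := by gcongr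
      _ = 2 * (n : ℝ) ^ 2 * x := by ring

/-- Pointwise: `Σ_k 𝟙[t ≤ ϑ_k]·g(t) = Ñ(t)·g(t)` for `t > 0`.
[cite: Voros2006, §3 p.5–6 (Oesterlé's argument; arXiv:math/0506326 chunk p0005:L60–L80)] -/
theorem tsum_indicator_eq {ϑ : ℕ → ℝ} (hs : Summable (fun k => ϑ k ^ 2)) {t : ℝ}
    (ht : 0 < t) (g : ℝ → ℝ) :
    ∑' k, (Iic (ϑ k)).indicator g t = (({k : ℕ | t ≤ ϑ k} : Set ℕ).ncard : ℝ) * g t := by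
  have hfin := finite_ge hs ht
  rw [tsum_eq_sum (s := hfin.toFinset) (fun k hk => ?_)]
  · rw [Set.ncard_eq_toFinset_card _ hfin]
    have : ∀ k ∈ hfin.toFinset, (Iic (ϑ k)).indicator g t = g t := by
      intro k hk
      rw [Set.Finite.mem_toFinset] at hk
      exact Set.indicator_of_mem (by simpa using hk) _
    rw [Finset.sum_congr rfl this, Finset.sum_const, nsmul_eq_mul]
  · rw [Set.Finite.mem_toFinset] at hk
    exact Set.indicator_of_notMem (by simpa using hk) _

/-- **Layer-cake / integration by parts**: `Σ_k 2(1 − cos(nϑ_k)) = ∫₀^∞ Ñ(t)·2n sin(nt) dt` («then integrate by parts: `n⁻¹λ_n = 2∫₀^π sin nθ N(½cot(θ/2)) dθ`»; here via Fubini on the layers, absolutely convergent).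
[cite: Voros2006, §3 p.5–6 (Oesterlé's argument; arXiv:math/0506326 chunk p0005:L60–L80)] -/
theorem tsum_eq_integral {ϑ : ℕ → ℝ} (h0 : ∀ k, 0 ≤ ϑ k) (hs : Summable (fun k => ϑ k ^ 2)) (n : ℕ) :
    ∑' k, 2 * (1 - Real.cos (n * ϑ k)) =
      ∫ t in Ioi (0:ℝ), (({k : ℕ | t ≤ ϑ k} : Set ℕ).ncard : ℝ) * (2 * (n : ℝ) * Real.sin (n * t)) := by
  have h1 : ∀ k, 2 * (1 - Real.cos (n * ϑ k)) =
      ∫ t in Ioi (0:ℝ), (Iic (ϑ k)).indicator (fun t => 2 * (n : ℝ) * Real.sin (n * t)) t :=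
    fun k => (integral_indicator_sin (h0 k) n).symm
  simp_rw [h1]
  rw [integral_tsum_of_summable_integral_norm (fun k => integrable_indicator_sin (ϑ k) n)]
  · refine setIntegral_congr_fun measurableSet_Ioi fun t ht => ?_
    exact tsum_indicator_eq hs ht _
  · refine Summable.of_nonneg_of_le (fun k => integral_nonneg fun t => norm_nonneg _)
      (fun k => integral_norm_indicator_sin_le (h0 k) n) ?_
    have := hs.mul_left (2 * (n : ℝ) ^ 2)
    refine this.congr fun k => ?_
    ring


/-! ## S5. The error term `E = Ñ − 𝟙_{(0,π)}·M` is integrable on `(0, ∞)` -/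

/-- `Ñ(t) = N(½cot(t/2))` for `t ∈ (0, π)`: the sets `{k : t ≤ θ(τ_k)}` and `{k : τ_k ≤ 1/(2 tan(t/2))}` coincide.
[cite: Voros2006, §3 p.5–6 (Oesterlé's argument; arXiv:math/0506326 chunk p0005:L60–L80)] -/
theorem setOf_le_theta_eq {τ : ℕ → ℝ} (hτ : ∀ k, 0 < τ k) {t : ℝ} (ht : 0 < t) (htπ : t < π) :
    ({k : ℕ | t ≤ 2 * Real.arctan (1 / (2 * τ k))} : Set ℕ) = {k : ℕ | τ k ≤ 1 / (2 * Real.tan (t / 2))} := by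
  ext k
  exact le_theta_iff (hτ k) ht htπ

/-- `Ñ(t) = 0` for `t ≥ π` (all `θ(τ_k) < π`).
[cite: Voros2006, §3 p.5–6 (Oesterlé's argument; arXiv:math/0506326 chunk p0005:L60–L80)] -/
theorem setOf_le_theta_eq_empty {τ : ℕ → ℝ} {t : ℝ} (ht : π ≤ t) :
    ({k : ℕ | t ≤ 2 * Real.arctan (1 / (2 * τ k))} : Set ℕ) = ∅ := by
  ext k
  simp only [Set.mem_setOf_eq, Set.mem_empty_iff_false, iff_false, not_le]
  exact lt_of_lt_of_le (theta_lt_pi (τ k)) ht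

/-- `Ñ` is antitone on `(0, ∞)` (hence measurable there).
[cite: Voros2006, §3 p.5–6 (Oesterlé's argument; arXiv:math/0506326 chunk p0005:L60–L80)] -/
theorem antitoneOn_count {ϑ : ℕ → ℝ} (hs : Summable (fun k => ϑ k ^ 2)) :
    AntitoneOn (fun t : ℝ => (({k : ℕ | t ≤ ϑ k} : Set ℕ).ncard : ℝ)) (Ioi 0) := by
  intro a ha b _ hab
  have hsub : ({k : ℕ | b ≤ ϑ k} : Set ℕ) ⊆ {k : ℕ | a ≤ ϑ k} := fun k hk => le_trans hab hk
  have := Set.ncard_le_ncard hsub (finite_ge hs ha)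
  dsimp only
  exact_mod_cast this

/-- The smooth part in expanded form: `2x[2R₋₂(log x − 1) + R₋₁] = 4R₋₂·x log x + (2R₋₁ − 4R₋₂)·x`.
[cite: Voros2006, §3 p.5–6 (Oesterlé's argument; arXiv:math/0506326 chunk p0005:L60–L80)] -/
theorem smooth_expand (R₂ R₁ x : ℝ) :
    2 * x * (2 * R₂ * (Real.log x - 1) + R₁) = 4 * R₂ * (x * Real.log x) + (2 * R₁ - 4 * R₂) * x := by
  ring

/-- `|a log a − b log b| ≤ 1/4` for `b = 1/t`, `0 < t ≤ 1`, `b − t/8 ≤ a ≤ b`, `1 ≤ a` (replacing `N(½cot(θ/2))`'s argument by `1/θ` costs a bounded amount — part of the «other `O(θ^{−α})` terms»).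
[cite: Voros2006, §3 p.5–6 (Oesterlé's argument; arXiv:math/0506326 chunk p0005:L60–L80)] -/
theorem abs_xlogx_sub_le {t a : ℝ} (ht : 0 < t) (ht1 : t ≤ 1) (ha1 : 1 ≤ a)
    (hlo : 1 / t - t / 8 ≤ a) (hhi : a ≤ 1 / t) :
    |a * Real.log a - (1 / t) * Real.log (1 / t)| ≤ 1 / 4 := by
  set b : ℝ := 1 / t with hb
  have ha0 : 0 < a := by linarith
  have hb0 : 0 < b := by rw [hb]; positivity
  have hlogb : Real.log b = -Real.log t := by rw [hb, one_div, Real.log_inv]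
  have hlogt : Real.log t ≤ 0 := Real.log_nonpos ht.le ht1
  have hba : b - a ≤ t / 8 := by linarith
  have hba0 : 0 ≤ b - a := by linarith
  -- decomposition
  have hdec : a * Real.log a - b * Real.log b = (a - b) * Real.log b + a * (Real.log a - Real.log b) := by
    ring
  -- first piece
  have h1 : |(a - b) * Real.log b| ≤ 1 / 8 := by
    rw [abs_mul, hlogb, abs_neg, show |a - b| = b - a by rw [abs_sub_comm]; exact abs_of_nonneg hba0,
      abs_of_nonpos hlogt]
    have hlt := Real.abs_log_mul_self_lt t ht ht1
    rw [abs_lt] at hlt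
    calc (b - a) * -Real.log t ≤ t / 8 * -Real.log t := by
          apply mul_le_mul_of_nonneg_right hba; linarith
      _ = -(Real.log t * t) / 8 := by ring
      _ ≤ 1 / 8 := by linarith [hlt.1]
  -- second piece
  have h2 : |a * (Real.log a - Real.log b)| ≤ 1 / 8 := by
    have hle : Real.log a ≤ Real.log b := Real.log_le_log ha0 hhi
    rw [abs_mul, abs_of_pos ha0, abs_of_nonpos (by linarith), neg_sub]
    have : Real.log b - Real.log a ≤ b / a - 1 := by
      rw [← Real.log_div hb0.ne' ha0.ne']
      exact Real.log_le_sub_one_of_pos (by positivity)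
    calc a * (Real.log b - Real.log a) ≤ a * (b / a - 1) := mul_le_mul_of_nonneg_left this ha0.le
      _ = b - a := by field_simp
      _ ≤ t / 8 := hba
      _ ≤ 1 / 8 := by linarith
  rw [hdec]
  calc |(a - b) * Real.log b + a * (Real.log a - Real.log b)|
      ≤ |(a - b) * Real.log b| + |a * (Real.log a - Real.log b)| := abs_add_le _ _
    _ ≤ 1 / 8 + 1 / 8 := add_le_add h1 h2
    _ = 1 / 4 := by norm_num

/-- `|S(a) − S(1/t)| ≤ |R₋₂| + |2R₋₁ − 4R₋₂|` for `S(x) = 2x[2R₋₂(log x − 1) + R₋₁]`, `1/t − t/8 ≤ a ≤ 1/t`, `1 ≤ a`, `0 < t ≤ 1`.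
[cite: Voros2006, §3 p.5–6 (Oesterlé's argument; arXiv:math/0506326 chunk p0005:L60–L80)] -/
theorem abs_smooth_sub_le {R₂ R₁ t a : ℝ} (ht : 0 < t) (ht1 : t ≤ 1) (ha1 : 1 ≤ a)
    (hlo : 1 / t - t / 8 ≤ a) (hhi : a ≤ 1 / t) :
    |2 * a * (2 * R₂ * (Real.log a - 1) + R₁) - 2 * (1 / t) * (2 * R₂ * (Real.log (1 / t) - 1) + R₁)| ≤
      |R₂| + |2 * R₁ - 4 * R₂| := by
  have h1 := abs_xlogx_sub_le ht ht1 ha1 hlo hhi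
  have h2 : |a - 1 / t| ≤ 1 := by
    rw [abs_le]; constructor <;> nlinarith
  rw [smooth_expand, smooth_expand]
  have : 4 * R₂ * (a * Real.log a) + (2 * R₁ - 4 * R₂) * a -
      (4 * R₂ * (1 / t * Real.log (1 / t)) + (2 * R₁ - 4 * R₂) * (1 / t)) =
      4 * R₂ * (a * Real.log a - 1 / t * Real.log (1 / t)) + (2 * R₁ - 4 * R₂) * (a - 1 / t) := by ring
  rw [this]
  calc _ ≤ |4 * R₂ * (a * Real.log a - 1 / t * Real.log (1 / t))| + |(2 * R₁ - 4 * R₂) * (a - 1 / t)| :=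
        abs_add_le _ _
    _ = 4 * |R₂| * |a * Real.log a - 1 / t * Real.log (1 / t)| + |2 * R₁ - 4 * R₂| * |a - 1 / t| := by
        rw [abs_mul, abs_mul, abs_mul]; norm_num
    _ ≤ 4 * |R₂| * (1 / 4) + |2 * R₁ - 4 * R₂| * 1 := by gcongr
    _ = |R₂| + |2 * R₁ - 4 * R₂| := by ring

/-- The main density `M(t) = S(1/t) = (1/t)[4R₋₂(log(1/t) − 1) + 2R₋₁]` is bounded on `[t₀, π]`, `t₀ > 0`.
[cite: Voros2006, §3 p.5–6 (Oesterlé's argument; arXiv:math/0506326 chunk p0005:L60–L80)] -/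
theorem abs_M_le {R₂ R₁ t₀ t : ℝ} (ht₀ : 0 < t₀) (h1 : t₀ ≤ t) (h2 : t ≤ π) :
    |2 * (1 / t) * (2 * R₂ * (Real.log (1 / t) - 1) + R₁)| ≤
      2 / t₀ * (2 * |R₂| * (|Real.log t₀| + |Real.log π| + 1) + |R₁|) := by
  have ht : 0 < t := lt_of_lt_of_le ht₀ h1
  have hlog : |Real.log t| ≤ |Real.log t₀| + |Real.log π| := by
    have := abs_le_max_abs_abs (Real.log_le_log ht₀ h1) (Real.log_le_log ht h2)
    exact this.trans (max_le_add_of_nonneg (abs_nonneg _) (abs_nonneg _))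
  have hinner : |2 * R₂ * (Real.log (1 / t) - 1) + R₁| ≤ 2 * |R₂| * (|Real.log t₀| + |Real.log π| + 1) + |R₁| := by
    rw [one_div, Real.log_inv]
    calc |2 * R₂ * (-Real.log t - 1) + R₁| ≤ |2 * R₂ * (-Real.log t - 1)| + |R₁| := abs_add_le _ _
      _ = 2 * |R₂| * |-Real.log t - 1| + |R₁| := by rw [abs_mul, abs_mul, abs_two]
      _ ≤ 2 * |R₂| * (|Real.log t₀| + |Real.log π| + 1) + |R₁| := by
          gcongr
          have e1 : |-Real.log t - 1| ≤ |Real.log t| + 1 := by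
            rw [abs_le]
            constructor <;> linarith [neg_abs_le (Real.log t), le_abs_self (Real.log t)]
          linarith
  rw [abs_mul, abs_mul, abs_two, abs_of_pos (by positivity : (0:ℝ) < 1 / t)]
  have h3 : 2 * (1 / t) ≤ 2 / t₀ := by
    rw [mul_one_div]; exact div_le_div_of_nonneg_left (by norm_num) ht₀ h1
  calc 2 * (1 / t) * |2 * R₂ * (Real.log (1 / t) - 1) + R₁|
      ≤ 2 / t₀ * (2 * |R₂| * (|Real.log t₀| + |Real.log π| + 1) + |R₁|) :=
        mul_le_mul h3 hinner (abs_nonneg _) (by positivity)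


/-- **The pointwise error bound**: `|Ñ(t) − M(t)| ≤ K + C·t^{−a}` on `(0, π)` with `0 ≤ a < 1` («(NT) makes `δN(½cot(θ/2))` integrable over the closed interval `[0, π]`»: it is `O(θ^{−α})` near `0` and bounded away from `0`).
[cite: Voros2006, §3 p.5–6 (Oesterlé's argument; arXiv:math/0506326 chunk p0005:L60–L80)] -/
theorem exists_error_bound {τ : ℕ → ℝ} {R₂ R₁ α : ℝ} (hτ : ∀ k, 0 < τ k) (hmono : Monotone τ)
    (hlim : Tendsto τ atTop atTop) (hα : α < 1)
    (hNT : (fun T : ℝ ↦ (Nat.card {k : ℕ | τ k ≤ T} : ℝ) - 2 * T * (2 * R₂ * (Real.log T - 1) + R₁))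
      =O[atTop] (fun T : ℝ ↦ T ^ α)) :
    ∃ K C a : ℝ, 0 ≤ K ∧ 0 ≤ C ∧ 0 ≤ a ∧ a < 1 ∧ ∀ t ∈ Ioo (0:ℝ) π,
      |(({k : ℕ | t ≤ 2 * Real.arctan (1 / (2 * τ k))} : Set ℕ).ncard : ℝ) -
          2 * (1 / t) * (2 * R₂ * (Real.log (1 / t) - 1) + R₁)| ≤ K + C * t ^ (-a) := by
  obtain ⟨C₀, T₀, hC₀, hT₀, hB⟩ := exists_NT_bound hNT
  have hsum := summable_theta_sq hτ hmono hlim hα hNT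
  set a : ℝ := max α 0 with ha
  have ha0 : 0 ≤ a := le_max_right _ _
  have ha1 : a < 1 := max_lt hα one_pos
  set t₀ : ℝ := min 1 (1 / (T₀ + 1)) with ht₀
  have ht₀0 : 0 < t₀ := lt_min one_pos (by positivity)
  have ht₀1 : t₀ ≤ 1 := min_le_left _ _
  have ht₀π : t₀ < π := lt_of_le_of_lt ht₀1 (by linarith [Real.pi_gt_three])
  -- the constants
  set K₂ : ℝ := |R₂| + |2 * R₁ - 4 * R₂| with hK₂
  set N₀ : ℝ := (({k : ℕ | t₀ ≤ 2 * Real.arctan (1 / (2 * τ k))} : Set ℕ).ncard : ℝ) with hN₀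
  set K₃ : ℝ := 2 / t₀ * (2 * |R₂| * (|Real.log t₀| + |Real.log π| + 1) + |R₁|) with hK₃
  have hK₂0 : 0 ≤ K₂ := by positivity
  have hN₀0 : 0 ≤ N₀ := Nat.cast_nonneg _
  have hK₃0 : 0 ≤ K₃ := by positivity
  refine ⟨K₂ + N₀ + K₃, C₀, a, by positivity, hC₀, ha0, ha1, fun t ht => ?_⟩
  obtain ⟨ht0, htπ⟩ := ht
  have hta : 0 ≤ C₀ * t ^ (-a) := mul_nonneg hC₀ (Real.rpow_nonneg ht0.le _)
  rcases le_or_gt t t₀ with hle | hgt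
  · -- small `t`: use `(NT)` at `T(t)` and the smooth comparison
    have ht1 : t ≤ 1 := hle.trans ht₀1
    set T : ℝ := 1 / (2 * Real.tan (t / 2)) with hT
    have hTlo : 1 / t - t / 8 ≤ T := Tinv_ge ht0 htπ
    have hThi : T ≤ 1 / t := Tinv_le ht0 htπ
    have h1t : T₀ + 1 ≤ 1 / t := by
      have h1 : t ≤ 1 / (T₀ + 1) := hle.trans (min_le_right _ _)
      rw [le_one_div (by positivity) ht0]  -- ? careful
      exact h1
    have hT₀T : T₀ ≤ T := by linarith
    have hT1 : 1 ≤ T := hT₀.trans hT₀T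
    have hT0 : 0 < T := by linarith
    -- `Ñ(t) = N(T)`
    have hNN : (({k : ℕ | t ≤ 2 * Real.arctan (1 / (2 * τ k))} : Set ℕ).ncard : ℝ) =
        (({k : ℕ | τ k ≤ T} : Set ℕ).ncard : ℝ) := by
      rw [setOf_le_theta_eq hτ ht0 htπ]
    -- `(NT)` at `T`
    have hNT' := hB T hT₀T
    have hpow : C₀ * T ^ a ≤ C₀ * t ^ (-a) := by
      apply mul_le_mul_of_nonneg_left _ hC₀
      calc T ^ a ≤ (1 / t) ^ a := Real.rpow_le_rpow hT0.le hThi ha0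
        _ = t ^ (-a) := by rw [one_div, Real.inv_rpow ht0.le, Real.rpow_neg ht0.le]
    -- smooth comparison
    have hsm := abs_smooth_sub_le (R₂ := R₂) (R₁ := R₁) ht0 ht1 hT1 hTlo hThi
    rw [hNN]
    have : (({k : ℕ | τ k ≤ T} : Set ℕ).ncard : ℝ) - 2 * (1 / t) * (2 * R₂ * (Real.log (1 / t) - 1) + R₁) =
        ((({k : ℕ | τ k ≤ T} : Set ℕ).ncard : ℝ) - 2 * T * (2 * R₂ * (Real.log T - 1) + R₁)) +
        (2 * T * (2 * R₂ * (Real.log T - 1) + R₁) - 2 * (1 / t) * (2 * R₂ * (Real.log (1 / t) - 1) + R₁)) := by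
      ring
    rw [this]
    calc _ ≤ |(({k : ℕ | τ k ≤ T} : Set ℕ).ncard : ℝ) - 2 * T * (2 * R₂ * (Real.log T - 1) + R₁)| +
          |2 * T * (2 * R₂ * (Real.log T - 1) + R₁) - 2 * (1 / t) * (2 * R₂ * (Real.log (1 / t) - 1) + R₁)| :=
          abs_add_le _ _
      _ ≤ C₀ * T ^ a + K₂ := add_le_add hNT' hsm
      _ ≤ C₀ * t ^ (-a) + K₂ := by linarith
      _ ≤ K₂ + N₀ + K₃ + C₀ * t ^ (-a) := by linarith
  · -- `t ∈ (t₀, π)`: everything is bounded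
    have hanti := antitoneOn_count (ϑ := fun k => 2 * Real.arctan (1 / (2 * τ k))) hsum
    have hNle : (({k : ℕ | t ≤ 2 * Real.arctan (1 / (2 * τ k))} : Set ℕ).ncard : ℝ) ≤ N₀ := by
      have := hanti (show t₀ ∈ Ioi (0:ℝ) from ht₀0) (show t ∈ Ioi (0:ℝ) from ht0) hgt.le
      dsimp only at this
      rw [hN₀]
      exact this
    have hN0 : 0 ≤ (({k : ℕ | t ≤ 2 * Real.arctan (1 / (2 * τ k))} : Set ℕ).ncard : ℝ) := Nat.cast_nonneg _
    have hM := abs_M_le (R₂ := R₂) (R₁ := R₁) ht₀0 hgt.le htπ.le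
    calc _ ≤ |(({k : ℕ | t ≤ 2 * Real.arctan (1 / (2 * τ k))} : Set ℕ).ncard : ℝ)| +
          |2 * (1 / t) * (2 * R₂ * (Real.log (1 / t) - 1) + R₁)| := abs_sub _ _
      _ ≤ N₀ + K₃ := add_le_add (by rwa [abs_of_nonneg hN0]) hM
      _ ≤ K₂ + N₀ + K₃ + C₀ * t ^ (-a) := by linarith


/-- **The error term `E = Ñ − 𝟙_{(0,π)}·M` is integrable on `(0, ∞)`** (dominated by `𝟙_{(0,π)}(K + C t^{−a})`, `a < 1`).
[cite: Voros2006, §3 p.5–6 (Oesterlé's argument; arXiv:math/0506326 chunk p0005:L60–L80)] -/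
theorem integrableOn_error {τ : ℕ → ℝ} {R₂ R₁ α : ℝ} (hτ : ∀ k, 0 < τ k) (hmono : Monotone τ)
    (hlim : Tendsto τ atTop atTop) (hα : α < 1)
    (hNT : (fun T : ℝ ↦ (Nat.card {k : ℕ | τ k ≤ T} : ℝ) - 2 * T * (2 * R₂ * (Real.log T - 1) + R₁))
      =O[atTop] (fun T : ℝ ↦ T ^ α)) :
    IntegrableOn (fun t : ℝ => (({k : ℕ | t ≤ 2 * Real.arctan (1 / (2 * τ k))} : Set ℕ).ncard : ℝ) -
        (Ioo (0:ℝ) π).indicator (fun t => 2 * (1 / t) * (2 * R₂ * (Real.log (1 / t) - 1) + R₁)) t)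
      (Ioi 0) := by
  obtain ⟨K, C, a, _, _, _, ha1, hb⟩ := exists_error_bound hτ hmono hlim hα hNT
  have hsum := summable_theta_sq hτ hmono hlim hα hNT
  have hN : AEStronglyMeasurable
      (fun t : ℝ => (({k : ℕ | t ≤ 2 * Real.arctan (1 / (2 * τ k))} : Set ℕ).ncard : ℝ))
      (volume.restrict (Ioi 0)) :=
    (aemeasurable_restrict_of_antitoneOn measurableSet_Ioi
      (antitoneOn_count (ϑ := fun k => 2 * Real.arctan (1 / (2 * τ k))) hsum)).aestronglyMeasurable
  have hMm : Measurable (fun t : ℝ => 2 * (1 / t) * (2 * R₂ * (Real.log (1 / t) - 1) + R₁)) :=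
    ((measurable_const.mul (measurable_const.div measurable_id)).mul
      ((measurable_const.mul ((Real.measurable_log.comp (measurable_const.div measurable_id)).sub
        measurable_const)).add measurable_const))
  have hM : AEStronglyMeasurable (fun t => (Ioo (0:ℝ) π).indicator
      (fun t => 2 * (1 / t) * (2 * R₂ * (Real.log (1 / t) - 1) + R₁)) t) (volume.restrict (Ioi 0)) :=
    (hMm.indicator measurableSet_Ioo).aestronglyMeasurable
  have hg : IntegrableOn (fun t : ℝ => (Ioo (0:ℝ) π).indicator (fun t => K + C * t ^ (-a)) t) (Ioi 0) := by
    rw [IntegrableOn, integrable_indicator_iff measurableSet_Ioo, IntegrableOn,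
      Measure.restrict_restrict measurableSet_Ioo,
      show Ioo (0:ℝ) π ∩ Ioi 0 = Ioo 0 π from Set.inter_eq_left.2 Ioo_subset_Ioi_self]
    have h1 : IntervalIntegrable (fun t : ℝ => K + C * t ^ (-a)) volume 0 π :=
      intervalIntegrable_const.add ((intervalIntegral.intervalIntegrable_rpow' (by linarith)).const_mul C)
    exact (intervalIntegrable_iff_integrableOn_Ioo_of_le Real.pi_pos.le).1 h1
  refine Integrable.mono' hg (hN.sub hM) (ae_restrict_of_forall_mem measurableSet_Ioi fun t ht => ?_)
  rcases lt_or_ge t π with htπ | htπ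
  · have hmem : t ∈ Ioo (0:ℝ) π := ⟨ht, htπ⟩
    rw [Set.indicator_of_mem hmem, Set.indicator_of_mem hmem, Real.norm_eq_abs]
    exact hb t hmem
  · have hnmem : t ∉ Ioo (0:ℝ) π := fun h => absurd h.2 (not_lt.2 htπ)
    rw [Set.indicator_of_notMem hnmem, Set.indicator_of_notMem hnmem, setOf_le_theta_eq_empty htπ]
    simp

/-! ## S6. Riemann–Lebesgue: `∫₀^∞ E(t) sin(nt) dt → 0` -/

/-- **Riemann–Lebesgue step**: `∫₀^∞ E(t) sin(nt) dt → 0` («the error is `o(1)` by the Riemann–Lebesgue lemma»; tree lemma `Literature.Analysis.Fourier.tendsto_integral_Ioi_mul_sin_atTop`).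
[cite: Voros2006, §3 p.5–6 (Oesterlé's argument; arXiv:math/0506326 chunk p0005:L60–L80)] -/
theorem tendsto_error_integral {τ : ℕ → ℝ} {R₂ R₁ α : ℝ} (hτ : ∀ k, 0 < τ k) (hmono : Monotone τ)
    (hlim : Tendsto τ atTop atTop) (hα : α < 1)
    (hNT : (fun T : ℝ ↦ (Nat.card {k : ℕ | τ k ≤ T} : ℝ) - 2 * T * (2 * R₂ * (Real.log T - 1) + R₁))
      =O[atTop] (fun T : ℝ ↦ T ^ α)) :
    Tendsto (fun n : ℕ => ∫ t in Ioi (0:ℝ),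
      ((({k : ℕ | t ≤ 2 * Real.arctan (1 / (2 * τ k))} : Set ℕ).ncard : ℝ) -
        (Ioo (0:ℝ) π).indicator (fun t => 2 * (1 / t) * (2 * R₂ * (Real.log (1 / t) - 1) + R₁)) t) *
        Real.sin (n * t)) atTop (𝓝 0) :=
  (Literature.Analysis.Fourier.tendsto_integral_Ioi_mul_sin_atTop
    (integrableOn_error hτ hmono hlim hα hNT)).comp tendsto_natCast_atTop_atTop

/-! ## S7. The main term: `∫₀^π M(t) sin(ct) dt = a·(log c·Si(cπ) − L(cπ)) + b·Si(cπ)` -/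

open Literature.NumberTheory.ConnesConsani2021 in
/-- «change variable: `nθ = t`»: `∫₀^π sin(ct)/t dt = Si(cπ)` for `c > 0` (`Si` = the tree's `sinIntegral`).
[cite: Voros2006, §3 p.5–6 (Oesterlé's argument; arXiv:math/0506326 chunk p0005:L60–L80)] -/
theorem integral_sin_mul_div {c : ℝ} (hc : 0 < c) :
    ∫ t in (0:ℝ)..π, Real.sin (c * t) / t = sinIntegral (c * π) := by
  have h1 : ∀ t : ℝ, Real.sin (c * t) / t = c * (Real.sin (c * t) / (c * t)) := by
    intro t
    rcases eq_or_ne t 0 with rfl | ht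
    · simp
    · field_simp
  simp_rw [h1]
  rw [intervalIntegral.integral_const_mul,
    intervalIntegral.integral_comp_mul_left (fun s => Real.sin s / s) hc.ne', mul_zero, smul_eq_mul,
    ← mul_assoc, mul_inv_cancel₀ hc.ne', one_mul, sinIntegral]

/-- Interval integrability of `sin(ct)/t` (bounded by `|c|`).
[cite: Voros2006, §3 p.5–6 (Oesterlé's argument; arXiv:math/0506326 chunk p0005:L60–L80)] -/
theorem intervalIntegrable_sin_mul_div (c a b : ℝ) :
    IntervalIntegrable (fun t : ℝ => Real.sin (c * t) / t) volume a b := by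
  refine (intervalIntegrable_const (c := |c|)).mono_fun' (Measurable.aestronglyMeasurable (by fun_prop))
    (Filter.Eventually.of_forall fun t => ?_)
  show ‖Real.sin (c * t) / t‖ ≤ |c|
  rcases eq_or_ne t 0 with rfl | ht
  · simp
  · rw [Real.norm_eq_abs, abs_div, div_le_iff₀ (abs_pos.2 ht), ← abs_mul]
    exact Real.abs_sin_le_abs

open Literature.NumberTheory.ConnesConsani2021 in
/-- Interval integrability of `log s · sin s / s` (`log` is integrable at `0`, `|sin s/s| ≤ 1`).
[cite: Voros2006, §3 p.5–6 (Oesterlé's argument; arXiv:math/0506326 chunk p0005:L60–L80)] -/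
theorem intervalIntegrable_log_mul_sin_div (a b : ℝ) :
    IntervalIntegrable (fun s : ℝ => Real.log s * (Real.sin s / s)) volume a b := by
  have h := (intervalIntegral.intervalIntegrable_log' (a := a) (b := b))
  rw [intervalIntegrable_iff] at h ⊢
  refine h.mul_bdd (Measurable.aestronglyMeasurable (by fun_prop)) (c := 1)
    (Filter.Eventually.of_forall fun s => ?_)
  rw [Real.norm_eq_abs]
  exact abs_sin_div_self_le_one s

open Literature.NumberTheory.ConnesConsani2021 in
/-- «change variable: `nθ = t`» for the logarithmic part: `∫₀^π log t · sin(ct)/t dt = ∫₀^{cπ} log s · sin s/s ds − log c · Si(cπ)` (`c > 0`).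
[cite: Voros2006, §3 p.5–6 (Oesterlé's argument; arXiv:math/0506326 chunk p0005:L60–L80)] -/
theorem integral_log_mul_sin_mul_div {c : ℝ} (hc : 0 < c) :
    ∫ t in (0:ℝ)..π, Real.log t * (Real.sin (c * t) / t) =
      (∫ s in (0:ℝ)..(c * π), Real.log s * (Real.sin s / s)) - Real.log c * sinIntegral (c * π) := by
  -- pointwise: `log t · sin(ct)/t = c · g(ct) − log c · sin(ct)/t`, `g(s) = log s · sin s / s`
  have h1 : ∀ t : ℝ, Real.log t * (Real.sin (c * t) / t) =
      c * (Real.log (c * t) * (Real.sin (c * t) / (c * t))) - Real.log c * (Real.sin (c * t) / t) := by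
    intro t
    rcases eq_or_ne t 0 with rfl | ht
    · simp
    · rw [Real.log_mul hc.ne' ht]
      field_simp
      ring
  simp_rw [h1]
  have hi1 : IntervalIntegrable (fun t => c * (Real.log (c * t) * (Real.sin (c * t) / (c * t)))) volume 0 π := by
    have := (intervalIntegrable_log_mul_sin_div 0 (c * π)).comp_mul_left (c := c)
    rw [zero_div, mul_div_cancel_left₀ _ hc.ne'] at this
    exact this.const_mul c
  have hi2 : IntervalIntegrable (fun t => Real.log c * (Real.sin (c * t) / t)) volume 0 π :=
    (intervalIntegrable_sin_mul_div c 0 π).const_mul _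
  rw [intervalIntegral.integral_sub hi1 hi2, intervalIntegral.integral_const_mul,
    intervalIntegral.integral_const_mul, integral_sin_mul_div hc,
    intervalIntegral.integral_comp_mul_left (fun s => Real.log s * (Real.sin s / s)) hc.ne',
    mul_zero, smul_eq_mul, ← mul_assoc, mul_inv_cancel₀ hc.ne', one_mul]

/-- Interval integrability of `log t · sin(ct)/t` (`|sin(ct)/t| ≤ |c|`).
[cite: Voros2006, §3 p.5–6 (Oesterlé's argument; arXiv:math/0506326 chunk p0005:L60–L80)] -/
theorem intervalIntegrable_log_mul_sin_mul_div (c a b : ℝ) :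
    IntervalIntegrable (fun t : ℝ => Real.log t * (Real.sin (c * t) / t)) volume a b := by
  have h := (intervalIntegral.intervalIntegrable_log' (a := a) (b := b))
  rw [intervalIntegrable_iff] at h ⊢
  refine h.mul_bdd (Measurable.aestronglyMeasurable (by fun_prop)) (c := |c|)
    (Filter.Eventually.of_forall fun t => ?_)
  rcases eq_or_ne t 0 with rfl | ht
  · simp
  · rw [Real.norm_eq_abs, abs_div, div_le_iff₀ (abs_pos.2 ht), ← abs_mul]
    exact Real.abs_sin_le_abs

open Literature.NumberTheory.ConnesConsani2021 in
/-- **The main term** «`n⁻¹λ_n = ∫₀^π sin nθ (1/θ)[8R₋₂(log(1/θ) − 1) + 4R₋₁] dθ + o(1)`» evaluated at finite `n`: with `a = 4R₋₂`, `b = 2R₋₁ − 4R₋₂`, `∫₀^π M(t) sin(ct) dt = a·log c·Si(cπ) − a·L(cπ) + b·Si(cπ)`, `L(A) = ∫₀^A log s·sin s/s ds`.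
[cite: Voros2006, §3 p.5–6 (Oesterlé's argument; arXiv:math/0506326 chunk p0005:L60–L80)] -/
theorem integral_M_mul_sin {R₂ R₁ c : ℝ} (hc : 0 < c) :
    ∫ t in (0:ℝ)..π, 2 * (1 / t) * (2 * R₂ * (Real.log (1 / t) - 1) + R₁) * Real.sin (c * t) =
      4 * R₂ * (Real.log c * sinIntegral (c * π)) -
        4 * R₂ * (∫ s in (0:ℝ)..(c * π), Real.log s * (Real.sin s / s)) +
        (2 * R₁ - 4 * R₂) * sinIntegral (c * π) := by
  have h1 : ∀ t : ℝ, 2 * (1 / t) * (2 * R₂ * (Real.log (1 / t) - 1) + R₁) * Real.sin (c * t) =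
      -(4 * R₂) * (Real.log t * (Real.sin (c * t) / t)) + (2 * R₁ - 4 * R₂) * (Real.sin (c * t) / t) := by
    intro t
    rw [one_div, Real.log_inv]
    ring
  simp_rw [h1]
  rw [intervalIntegral.integral_add ((intervalIntegrable_log_mul_sin_mul_div c 0 π).const_mul _)
      ((intervalIntegrable_sin_mul_div c 0 π).const_mul _),
    intervalIntegral.integral_const_mul, intervalIntegral.integral_const_mul,
    integral_log_mul_sin_mul_div hc, integral_sin_mul_div hc]
  ring


/-! ## S8. Assembly -/

/-- Interval integrability of `M(t)·sin(ct)` on `[0, π]`.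
[cite: Voros2006, §3 p.5–6 (Oesterlé's argument; arXiv:math/0506326 chunk p0005:L60–L80)] -/
theorem intervalIntegrable_M_mul_sin (R₂ R₁ c : ℝ) :
    IntervalIntegrable (fun t : ℝ => 2 * (1 / t) * (2 * R₂ * (Real.log (1 / t) - 1) + R₁) * Real.sin (c * t))
      volume 0 π := by
  have h1 : ∀ t : ℝ, 2 * (1 / t) * (2 * R₂ * (Real.log (1 / t) - 1) + R₁) * Real.sin (c * t) =
      -(4 * R₂) * (Real.log t * (Real.sin (c * t) / t)) + (2 * R₁ - 4 * R₂) * (Real.sin (c * t) / t) := by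
    intro t
    rw [one_div, Real.log_inv]
    ring
  simp_rw [h1]
  exact ((intervalIntegrable_log_mul_sin_mul_div c 0 π).const_mul _).add
    ((intervalIntegrable_sin_mul_div c 0 π).const_mul _)

/-- Splitting `∫₀^∞ Ñ(t)·2n sin(nt) dt = 2n·∫₀^π M(t) sin(nt) dt + 2n·∫₀^∞ E(t) sin(nt) dt`.
[cite: Voros2006, §3 p.5–6 (Oesterlé's argument; arXiv:math/0506326 chunk p0005:L60–L80)] -/
theorem integral_split {τ : ℕ → ℝ} {R₂ R₁ α : ℝ} (hτ : ∀ k, 0 < τ k) (hmono : Monotone τ)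
    (hlim : Tendsto τ atTop atTop) (hα : α < 1)
    (hNT : (fun T : ℝ ↦ (Nat.card {k : ℕ | τ k ≤ T} : ℝ) - 2 * T * (2 * R₂ * (Real.log T - 1) + R₁))
      =O[atTop] (fun T : ℝ ↦ T ^ α)) (n : ℕ) :
    ∫ t in Ioi (0:ℝ), (({k : ℕ | t ≤ 2 * Real.arctan (1 / (2 * τ k))} : Set ℕ).ncard : ℝ) *
        (2 * (n : ℝ) * Real.sin (n * t)) =
      2 * (n : ℝ) * (∫ t in (0:ℝ)..π, 2 * (1 / t) * (2 * R₂ * (Real.log (1 / t) - 1) + R₁) * Real.sin (n * t)) +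
      2 * (n : ℝ) * ∫ t in Ioi (0:ℝ),
        ((({k : ℕ | t ≤ 2 * Real.arctan (1 / (2 * τ k))} : Set ℕ).ncard : ℝ) -
          (Ioo (0:ℝ) π).indicator (fun t => 2 * (1 / t) * (2 * R₂ * (Real.log (1 / t) - 1) + R₁)) t) *
          Real.sin (n * t) := by
  have hE := integrableOn_error hτ hmono hlim hα hNT
  -- pointwise split
  have hpt : ∀ t : ℝ, (({k : ℕ | t ≤ 2 * Real.arctan (1 / (2 * τ k))} : Set ℕ).ncard : ℝ) * (2 * (n : ℝ) * Real.sin (n * t)) =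
      (Ioo (0:ℝ) π).indicator (fun t => 2 * (n : ℝ) * (2 * (1 / t) * (2 * R₂ * (Real.log (1 / t) - 1) + R₁) * Real.sin (n * t))) t +
        2 * (n : ℝ) * (((({k : ℕ | t ≤ 2 * Real.arctan (1 / (2 * τ k))} : Set ℕ).ncard : ℝ) - (Ioo (0:ℝ) π).indicator (fun t => 2 * (1 / t) * (2 * R₂ * (Real.log (1 / t) - 1) + R₁)) t) * Real.sin (n * t)) := by
    intro t
    by_cases ht : t ∈ Ioo (0:ℝ) π
    · rw [Set.indicator_of_mem ht, Set.indicator_of_mem ht]; ring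
    · rw [Set.indicator_of_notMem ht, Set.indicator_of_notMem ht]; ring
  simp_rw [hpt]
  -- integrability of the two pieces on `(0, ∞)`
  have hI1 : Integrable (fun t => (Ioo (0:ℝ) π).indicator
      (fun t => 2 * (n : ℝ) * (2 * (1 / t) * (2 * R₂ * (Real.log (1 / t) - 1) + R₁) * Real.sin (n * t))) t) (volume.restrict (Ioi 0)) := by
    rw [integrable_indicator_iff measurableSet_Ioo, IntegrableOn, Measure.restrict_restrict measurableSet_Ioo,
      show Ioo (0:ℝ) π ∩ Ioi 0 = Ioo 0 π from Set.inter_eq_left.2 Ioo_subset_Ioi_self]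
    have := ((intervalIntegrable_M_mul_sin R₂ R₁ n).const_mul (2 * (n : ℝ)))
    exact (intervalIntegrable_iff_integrableOn_Ioo_of_le Real.pi_pos.le).1 this
  have hI2 : Integrable (fun t => 2 * (n : ℝ) * (((({k : ℕ | t ≤ 2 * Real.arctan (1 / (2 * τ k))} : Set ℕ).ncard : ℝ) - (Ioo (0:ℝ) π).indicator (fun t => 2 * (1 / t) * (2 * R₂ * (Real.log (1 / t) - 1) + R₁)) t) *
      Real.sin (n * t))) (volume.restrict (Ioi 0)) := by
    refine Integrable.const_mul ?_ _
    exact hE.mul_bdd (Measurable.aestronglyMeasurable (by fun_prop)) (c := 1)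
      (Filter.Eventually.of_forall fun t => by rw [Real.norm_eq_abs]; exact Real.abs_sin_le_one _)
  rw [integral_add hI1 hI2, integral_const_mul]
  congr 1
  rw [setIntegral_indicator measurableSet_Ioo,
    show Ioi (0:ℝ) ∩ Ioo 0 π = Ioo 0 π from Set.inter_eq_right.2 Ioo_subset_Ioi_self,
    ← integral_Ioc_eq_integral_Ioo, ← intervalIntegral.integral_of_le Real.pi_pos.le,
    intervalIntegral.integral_const_mul]

open Literature.NumberTheory.ConnesConsani2021 in
/-- **Oesterlé's theorem `(NT) ⇒ (REs)` ([Voros2006] §3), modulo the classical constant** «the last integral evaluates in closed form [GR]»: `∫₀^∞ log s·sin s/s ds = −πγ/2` (Gradshteyn–Ryzhik 4.421 1), taken as the hypothesis `hJ` (the `∫₀^∞ sin s/s = π/2` half is the tree's `tendsto_sinIntegral_atTop`). The discharge `Voros2006_NT_REs_holds` applies this to the tree's log-sine integral theorem.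
[cite: Voros2006, §3 p.5–6 (Oesterlé's argument; arXiv:math/0506326 chunk p0005:L60–L80)] -/
theorem NT_REs_of_logSineIntegral
    (hJ : Tendsto (fun A : ℝ => ∫ s in (0:ℝ)..A, Real.log s * (Real.sin s / s)) atTop
      (𝓝 (-(π / 2) * Real.eulerMascheroniConstant))) :
    Voros2006_NT_REs := by
  intro τ hτ hmono hlim R₂ R₁ α hα hNT
  have hsum := summable_theta_sq hτ hmono hlim hα hNT
  set γ : ℝ := Real.eulerMascheroniConstant with hγ
  -- the four vanishing pieces
  set e : ℕ → ℝ := fun n => ∫ t in Ioi (0:ℝ),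
      ((({k : ℕ | t ≤ 2 * Real.arctan (1 / (2 * τ k))} : Set ℕ).ncard : ℝ) -
        (Ioo (0:ℝ) π).indicator (fun t => 2 * (1 / t) * (2 * R₂ * (Real.log (1 / t) - 1) + R₁)) t) *
        Real.sin (n * t) with he
  have hnπ : Tendsto (fun n : ℕ => (n : ℝ) * π) atTop atTop :=
    tendsto_natCast_atTop_atTop.atTop_mul_const Real.pi_pos
  have t3 : Tendsto (fun n : ℕ => sinIntegral (n * π) - π / 2) atTop (𝓝 0) := by
    have := (tendsto_sinIntegral_atTop.comp hnπ).sub_const (π / 2)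
    simpa using this
  have t1 : Tendsto (fun n : ℕ => Real.log n * (sinIntegral (n * π) - π / 2)) atTop (𝓝 0) := by
    have h1 := tendsto_log_mul_sinIntegral_sub.comp hnπ
    have h2 : Tendsto (fun n : ℕ => Real.log ((n : ℝ) * π) * (sinIntegral (n * π) - π / 2) -
        Real.log π * (sinIntegral (n * π) - π / 2)) atTop (𝓝 (0 - Real.log π * 0)) :=
      h1.sub (t3.const_mul _)
    rw [mul_zero, sub_zero] at h2
    refine h2.congr' ?_
    filter_upwards [eventually_ge_atTop 1] with n hn
    have hn0 : (n : ℝ) ≠ 0 := by exact_mod_cast (Nat.one_le_iff_ne_zero.1 hn)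
    rw [Real.log_mul hn0 Real.pi_pos.ne']
    ring
  have t2 : Tendsto (fun n : ℕ => (∫ s in (0:ℝ)..((n : ℝ) * π), Real.log s * (Real.sin s / s)) + π / 2 * γ)
      atTop (𝓝 0) := by
    have := (hJ.comp hnπ).add_const (π / 2 * γ)
    rw [show -(π / 2) * Real.eulerMascheroniConstant + π / 2 * γ = 0 by rw [hγ]; ring] at this
    exact this
  have t4 : Tendsto e atTop (𝓝 0) := tendsto_error_integral hτ hmono hlim hα hNT
  -- the bracket `g`
  set g : ℕ → ℝ := fun n => 4 * R₂ * (Real.log n * (sinIntegral (n * π) - π / 2)) -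
      4 * R₂ * ((∫ s in (0:ℝ)..((n : ℝ) * π), Real.log s * (Real.sin s / s)) + π / 2 * γ) +
      (2 * R₁ - 4 * R₂) * (sinIntegral (n * π) - π / 2) + e n with hg
  have hg0 : Tendsto g atTop (𝓝 0) := by
    have := (((t1.const_mul (4 * R₂)).sub (t2.const_mul (4 * R₂))).add (t3.const_mul (2 * R₁ - 4 * R₂))).add t4
    simpa using this
  -- the identity `f n = 2 n g n` for `n ≥ 1`
  have hid : ∀ᶠ n : ℕ in atTop,
      (∑' k : ℕ, 2 * (1 - ((1 - 1 / ((1 / 2 : ℂ) + τ k * Complex.I)) ^ n).re)) -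
        2 * Real.pi * n * (2 * R₂ * (Real.log n - 1 + Real.eulerMascheroniConstant) + R₁) =
      2 * g n * n := by
    filter_upwards [eventually_ge_atTop 1] with n hn
    have hn0 : (0 : ℝ) < n := by exact_mod_cast hn
    have e1 : (∑' k : ℕ, 2 * (1 - ((1 - 1 / ((1 / 2 : ℂ) + τ k * Complex.I)) ^ n).re)) =
        ∑' k : ℕ, 2 * (1 - Real.cos (n * (2 * Real.arctan (1 / (2 * τ k))))) :=
      tsum_congr fun k => summand_eq (hτ k) n
    rw [e1, tsum_eq_integral (ϑ := fun k => 2 * Real.arctan (1 / (2 * τ k))) (fun k => (theta_pos (hτ k)).le)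
      hsum n]
    rw [integral_split hτ hmono hlim hα hNT n, integral_M_mul_sin hn0, hg, he, hγ]
    ring
  -- conclusion
  have h2g : Tendsto (fun n => 2 * g n) atTop (𝓝 0) := by simpa using hg0.const_mul 2
  have hO : (fun n : ℕ => 2 * g n * n) =o[atTop] (fun n : ℕ => (n : ℝ)) := by
    have := ((isLittleO_one_iff ℝ).2 h2g).mul_isBigO (isBigO_refl (fun n : ℕ => (n : ℝ)) atTop)
    simpa using this
  exact hO.congr' (EventuallyEq.symm hid) EventuallyEq.rfl


/-! ## S9. The `ζ` instance under RH: `Voros2006_thm_onlyif` («for ζ under RH, R₋₂ = 1/(8π),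
R₋₁ = −log(2π)/(4π) (eq. (EX)) and (REs) is (RER)», via the Riemann–von Mangoldt formula) -/

/-- Under RH every non-trivial zero is `½ + i·Im ρ`.
[cite: Voros2006, §3 Theorem (asymptotic criterion), eq. (RER) p.6; (EX) p.5] -/
theorem coe_eq_half_add_im (hRH : RiemannHypothesis) (ρ : ZetaZeros.riemannZetaNontrivialZeros) :
    (ρ : ℂ) = (1 / 2 : ℂ) + (((ρ : ℂ).im : ℝ) : ℂ) * Complex.I := by
  obtain ⟨hz, hnt⟩ := ρ.2
  have h1 : (ρ : ℂ) ≠ 1 := ZetaZeros.riemannZetaNontrivialZeros.ne_one ρ.2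
  have hre : (ρ : ℂ).re = 1 / 2 := hRH (ρ : ℂ) hz (fun ⟨k, hk⟩ ↦ hnt ⟨k, hk.symm⟩) h1
  apply Complex.ext
  · simp [hre]
  · simp

/-- Conjugate symmetry of the summand: `Re[1 − (1 − 1/(½ − iy))ⁿ] = Re[1 − (1 − 1/(½ + iy))ⁿ]`
(the «+ c.c.» of (LDef)).
[cite: Voros2006, §3 Theorem (asymptotic criterion), eq. (RER) p.6; (EX) p.5] -/
theorem re_summand_neg (y : ℝ) (n : ℕ) :
    ((1 : ℂ) - (1 - 1 / ((1 / 2 : ℂ) + (((-y : ℝ)) : ℂ) * Complex.I)) ^ n).re =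
      ((1 : ℂ) - (1 - 1 / ((1 / 2 : ℂ) + (y : ℂ) * Complex.I)) ^ n).re := by
  have hc : (starRingEnd ℂ) ((1 / 2 : ℂ) + (y : ℂ) * Complex.I) =
      (1 / 2 : ℂ) + (((-y : ℝ)) : ℂ) * Complex.I := by
    apply Complex.ext
    · simp
    · simp
  have h : (1 : ℂ) - (1 - 1 / ((1 / 2 : ℂ) + (((-y : ℝ)) : ℂ) * Complex.I)) ^ n =
      (starRingEnd ℂ) ((1 : ℂ) - (1 - 1 / ((1 / 2 : ℂ) + (y : ℂ) * Complex.I)) ^ n) := by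
    rw [map_sub, map_one, map_pow, map_sub, map_one, map_div₀, map_one, hc]
  rw [h, Complex.conj_re]

/-- The Riemann–von Mangoldt formula in the shape `(NT)` of `Voros2006_NT_REs` for the enumeration
`γ_k = zetaOrdinate k`: `#{k : γ_k ≤ T} − 2T[2R₋₂(log T − 1) + R₋₁] = O(T^{1/2})` with
`R₋₂ = 1/(8π)`, `R₋₁ = −log(2π)/(4π)` (eq. (EX)); from the tree's `riemann_von_mangoldt_holds`
(`O(log T)`) and `zetaZeroCount_eq_ncard_holds`.
[cite: Voros2006, §3 Theorem (asymptotic criterion), eq. (RER) p.6; (EX) p.5] -/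
theorem NT_zetaOrdinate :
    (fun T : ℝ ↦ (Nat.card {k : ℕ | zetaOrdinate k ≤ T} : ℝ) -
        2 * T * (2 * (1 / (8 * π)) * (Real.log T - 1) + -Real.log (2 * π) / (4 * π)))
      =O[atTop] (fun T : ℝ ↦ T ^ (1 / 2 : ℝ)) := by
  have h1 := riemann_von_mangoldt_holds
  rw [riemann_von_mangoldt] at h1
  have h2 : (fun T : ℝ ↦ (zetaZeroCount T : ℝ) - (T / (2 * π) * Real.log (T / (2 * π)) - T / (2 * π)))
      =O[atTop] (fun T : ℝ ↦ T ^ (1 / 2 : ℝ)) :=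
    h1.trans (isLittleO_log_rpow_atTop (by norm_num)).isBigO
  refine h2.congr' ?_ EventuallyEq.rfl
  filter_upwards [eventually_gt_atTop 0] with T hT
  rw [Nat.card_coe_set_eq, ← zetaZeroCount_eq_ncard_holds T, Real.log_div hT.ne' (by positivity),
    Real.log_mul (by norm_num) Real.pi_pos.ne']
  field_simp
  ring

/-- **Oesterlé's theorem for `ζ` under RH, modulo the log-sine constant**: `RH ⇒ λ_n = ½n(log n − 1 + γ
− log 2π) + o(n)` ((RER)), from `NT_REs_of_logSineIntegral` at `R₋₂ = 1/(8π)`, `R₋₁ = −log(2π)/(4π)`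
(eq. (EX)), the Riemann–von Mangoldt formula (`NT_zetaOrdinate`), `λ_n = Σ_ρ m(ρ)Re[1 − (1 − 1/ρ)ⁿ]`
(`keiperLiCoeff_eq_tsum_zeros`) and the zero-set/ordinate dictionary
(`tsum_nontrivialZeros_eq_tsum_zetaOrdinate`).  RH-CONSEQUENCE (explicit binder); not RH.
[cite: Voros2006, §3 Theorem (asymptotic criterion), eq. (RER) p.6; (EX) p.5] -/
theorem thm_onlyif_of_logSineIntegral
    (hJ : Tendsto (fun A : ℝ => ∫ s in (0:ℝ)..A, Real.log s * (Real.sin s / s)) atTop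
      (𝓝 (-(π / 2) * Real.eulerMascheroniConstant))) :
    Voros2006_thm_onlyif := by
  intro hRH
  have hmain := NT_REs_of_logSineIntegral hJ zetaOrdinate zetaOrdinate_pos_holds zetaOrdinate_mono_holds
    tendsto_zetaOrdinate_atTop (1 / (8 * π)) (-Real.log (2 * π) / (4 * π)) (1 / 2) (by norm_num)
    NT_zetaOrdinate
  refine hmain.congr' ?_ EventuallyEq.rfl
  filter_upwards [eventually_ge_atTop 1] with n hn
  -- the complex-valued summand as a function of the ordinate
  set g : ℝ → ℂ := fun y ↦ ((((1 : ℂ) - (1 - 1 / ((1 / 2 : ℂ) + (y : ℂ) * Complex.I)) ^ n).re : ℝ) : ℂ)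
    with hg
  -- summability over the zero set (Bombieri–Lagarias/Li) and over the enumeration (S3)
  have hA : Summable fun ρ : ZetaZeros.riemannZetaNontrivialZeros ↦
      (riemannZetaZeroOrder (ρ : ℂ) : ℂ) * g (ρ : ℂ).im := by
    have h := (Complex.summable_ofReal.2 (summable_keiperLiTerm n))
    refine h.congr fun ρ ↦ ?_
    rw [hg]
    dsimp only
    rw [← coe_eq_half_add_im hRH ρ]
    push_cast
    ring
  have hsum := summable_summand zetaOrdinate_pos_holds zetaOrdinate_mono_holds tendsto_zetaOrdinate_atTop
    (by norm_num : (1 / 2 : ℝ) < 1) NT_zetaOrdinate n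
  have hsum' : Summable fun k : ℕ ↦
      2 * (1 - ((1 - 1 / ((1 / 2 : ℂ) + (zetaOrdinate k : ℂ) * Complex.I)) ^ n).re) :=
    hsum.congr fun k ↦ (summand_eq (zetaOrdinate_pos_holds k) n).symm
  have hgg : ∀ k : ℕ, g (zetaOrdinate k) + g (-zetaOrdinate k) =
      ((2 * (1 - ((1 - 1 / ((1 / 2 : ℂ) + (zetaOrdinate k : ℂ) * Complex.I)) ^ n).re) : ℝ) : ℂ) := by
    intro k
    rw [hg]
    dsimp only
    rw [show (((-zetaOrdinate k : ℝ)) : ℂ) = (((-zetaOrdinate k : ℝ)) : ℂ) from rfl, re_summand_neg,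
      Complex.sub_re, Complex.one_re]
    push_cast
    ring
  have hB : Summable fun k : ℕ ↦ g (zetaOrdinate k) + g (-zetaOrdinate k) := by
    have h := Complex.summable_ofReal.2 hsum'
    exact h.congr fun k ↦ (hgg k).symm
  -- the dictionary
  have hdict := tsum_nontrivialZeros_eq_tsum_zetaOrdinate g hA hB
  have hlam : keiperLiCoeff n =
      ∑' k : ℕ, 2 * (1 - ((1 - 1 / ((1 / 2 : ℂ) + (zetaOrdinate k : ℂ) * Complex.I)) ^ n).re) := by
    apply Complex.ofReal_injective
    rw [keiperLiCoeff_eq_tsum_zeros hn, Complex.ofReal_tsum, Complex.ofReal_tsum]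
    have e1 : ∀ ρ : ZetaZeros.riemannZetaNontrivialZeros,
        (((riemannZetaZeroOrder (ρ : ℂ) : ℝ) * (1 - (1 - 1 / (ρ : ℂ)) ^ n).re : ℝ) : ℂ) =
          (riemannZetaZeroOrder (ρ : ℂ) : ℂ) * g (ρ : ℂ).im := by
      intro ρ
      rw [hg]
      dsimp only
      rw [← coe_eq_half_add_im hRH ρ]
      push_cast
      ring
    rw [tsum_congr e1, hdict, tsum_congr hgg]
  rw [hlam]
  set L : ℝ := ∑' k : ℕ, 2 * (1 - ((1 - 1 / ((1 / 2 : ℂ) + (zetaOrdinate k : ℂ) * Complex.I)) ^ n).re) with hL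
  have hπ : π ≠ 0 := Real.pi_pos.ne'
  field_simp
  ring


/-! ## S10. The discharges -/

open Literature.NumberTheory.ConnesConsani2021 in
/-- «the last integral evaluates in closed form [GR]»: `∫₀^A log s·(sin s/s) ds → −πγ/2`, i.e.
`∫₀^∞ log s sin s/s ds = −(π/2)γ` (Gradshteyn–Ryzhik 4.421 1) — the tree's
`tendsto_intervalIntegral_sin_mul_log_div` (`SineIntegralLogAsymptotics.lean`) in the shape of `hJ`.
[cite: Voros2006, §3 p.5–6 (Oesterlé's argument; arXiv:math/0506326 chunk p0005:L60–L80)] -/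
theorem tendsto_logSineIntegral :
    Tendsto (fun A : ℝ => ∫ s in (0:ℝ)..A, Real.log s * (Real.sin s / s)) atTop
      (𝓝 (-(π / 2) * Real.eulerMascheroniConstant)) := by
  have h := tendsto_intervalIntegral_sin_mul_log_div
  have e : ∀ A : ℝ, ∫ s in (0:ℝ)..A, Real.log s * (Real.sin s / s) =
      ∫ t in (0:ℝ)..A, Real.sin t * Real.log t / t :=
    fun A => intervalIntegral.integral_congr fun t _ => by ring
  simp_rw [e]
  rw [show -(π / 2) * Real.eulerMascheroniConstant = -(π / 2 * Real.eulerMascheroniConstant) by ring]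
  exact h

end Voros2006Oesterle

/-- **DISCHARGE of `Voros2006_NT_REs`** — Oesterlé's theorem `(NT) ⇒ (REs)` for ordinates on the critical
line ([Voros2006] §3 p.5–6), PROVED: `Voros2006Oesterle.NT_REs_of_logSineIntegral` applied to the log-sine
integral `∫₀^∞ log s·sin s/s ds = −πγ/2`.  RH-FREE.
[cite: Voros2006, §3 eqs. (NT), (REs) p.5 and the proof p.5–6] -/
theorem Voros2006_NT_REs_holds : Voros2006_NT_REs :=
  Voros2006Oesterle.NT_REs_of_logSineIntegral Voros2006Oesterle.tendsto_logSineIntegral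

/-- **DISCHARGE of `Voros2006_thm_onlyif`** — `RH ⇒ λ_n = ½ n (log n − 1 + γ − log 2π) + o(n)` ((RER);
Oesterlé's theorem for `ζ`: `Voros2006_NT_REs` at `R₋₂ = 1/(8π)`, `R₋₁ = −log(2π)/(4π)` plus the Riemann–von
Mangoldt formula), PROVED.  RH-CONSEQUENCE (explicit binder `RiemannHypothesis →`); nothing here bears on the
truth of RH. [cite: Voros2006, §3 Theorem (asymptotic criterion), eq. (RER) p.6] -/
theorem Voros2006_thm_onlyif_holds : Voros2006_thm_onlyif :=
  Voros2006Oesterle.thm_onlyif_of_logSineIntegral Voros2006Oesterle.tendsto_logSineIntegral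

/-- RH-EQUIVALENT (l.1), now UNCONDITIONAL as an equivalence — **[Voros2006] Theorem (asymptotic criterion
for the Riemann Hypothesis), [RH true] line**: `RH ⇔ λ_n = ½ n (log n − 1 + γ − log 2π) + o(n)`; the tree's glue
`Voros2006_thm_iff` fed with `Voros2006_thm_onlyif_holds` (Oesterlé–Voros, this file) and
`Voros2006_thm_if_holds` (Bombieri–Lagarias, `KeiperLiAsymptoticCriteriaProofs.lean`).  An equivalence is not
a proof of either side; nothing here bears on the truth of RH.
[cite: Voros2006, §3 Theorem (asymptotic criterion), eq. (RER) p.6] -/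
theorem Voros2006_thm_iff_holds :
    RiemannHypothesis ↔
      (fun n : ℕ ↦ keiperLiCoeff n -
          (n : ℝ) / 2 * (Real.log n - 1 + Real.eulerMascheroniConstant - Real.log (2 * Real.pi)))
        =o[atTop] (fun n : ℕ ↦ (n : ℝ)) :=
  Voros2006_thm_iff Voros2006_thm_onlyif_holds Voros2006_thm_if_holds

end Literature.NumberTheory.LFunctions

end
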